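import Summits.Parity.BatemanHorn.Theses.SelbergDelangeRigidity
import Summits.Parity.BatemanHorn.Theorems.SystemLSDRealSegment.Negative.Engines
import Summits.Parity.BatemanHorn.Theorems.SystemLSDRealSegment.Negative.DivisorBound
import Summits.Parity.BatemanHorn.Theorems.SystemLSDRealSegment.Negative.OmegaWide
import Literature.NumberTheory.LFunctions.SelbergDelangeOmegaProofs

/-!
# Disproof work file for the crux `SelbergDelangeRigidity.LSDRealSegment` (stmt-Parity-9770)

Standing adversary's Lean record (refuter-cdisprove-stmt-Parity-9770-0, cycle 1; refuter-cdisprove-stmt-Parity-9770-g2-0,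
cycle 2 = §7–§8). Sorry-free (no NEAR-MISS stubs needed so far); axioms ⊆ {propext, Classical.choice, Quot.sound}.

The crux: for every Bateman–Horn system `f = (f_1,…,f_k)` there is `Λ` holomorphic on `|z| < 2` with
`Λ 0 = C(f) = batemanHornConst f` such that for every REAL `y ∈ (5/4, 7/4)`
`H_x(y) := x⁻¹ (log x)^{k(1-y)} Σ_{n ≤ x} y^{Ω_f(n)} → Λ(y) · D^{y-1} / Γ(y)^k`, `Ω_f(n) = Σ_i Ω(f_i(n))`
(`ArithmeticFunction.cardFactors`, values `≤ 0 ↦ 0` via `Int.toNat`), `D = ∏ natDegree f_i`.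

LANDED IN THE TREE (importable; namespace `Summit.Parity.BatemanHorn.Theorems.LSDRealSegment.Negative`, statements inline
the crux body verbatim):
* `Summits/Parity/BatemanHorn/Theorems/LSDRealSegment/Negative/LoadBearing.lean` (p74835) — §2–§3;
* `…/Negative/Structure.lean` (p74529) — §4;
* `…/Negative/WallAtTwo.lean` (p75826) — §5 (every `b > 2`); `…/Negative/OddDivisorSum.lean` (p75825) + `…/Negative/WallAtTwoSharp.lean`
  (p76210) — §5b (the endpoint `y = 2`). (All five ACCEPTED 2026-08-16.)
* Cycle 2: `…/Negative/LinearRung.lean` (p77648) — §7a–§7c; `…/Negative/SharpRadius.lean` (p79194) — §7d;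
  `…/Negative/OddLinear.lean` (p79612) — §7e. (All three ACCEPTED 2026-08-16.)
NUMERICS attached on the item: `evidence_cubic_numerics.md` (f = X³+2: `H_x(y)/Ψ(y) ∈ [0.995, 1.004]` at `x = 4·10⁵`,
`y ∈ {1.25, 1.4, 1.5, 1.6, 1.75}`; `λ_f(0) = 1.29844 = C(X³+2)`).

SIBLING. The crux `AlmostPrimeZeros.SystemLSDRealSegment` (stmt-Parity-11292) is the same law for the CAPPED
statistic `s_f = Σ_i Σ_p min(v_p(f_i(n)), 2)`; its disprover's landed negative files
`Theorems/SystemLSDRealSegment/Negative/{Engines,DivisorBound,OmegaWide}.lean` are IMPORTED here (generic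
engines: identity theorem from the segment, divergence from a divisor-type lower bound, `Σ 2^{ω(n)} ≥ (x/2)log x - x`,
the BH system `![X]`). Everything below is re-decided for the UN-capped `Ω` of this crux.

INDEX
* §1 restatement (`Conclusion`, `crux_iff` by `Iff.rfl`), `normSum_eq_ofReal`, `Ω ≥ ω`.
* §2 the degenerate instance `k = 0` HOLDS (`conclusion_fin_zero`): `C(∅) = 1`, `Λ ≡ 1`.
* §3 LOAD-BEARING ANALYSIS of the four fields of `IsBatemanHornSystem` (crux with one field dropped):
  `false_without_leadingCoeff_pos` (witness `![-X]`: statistic ≡ 0, `H_x → 0`, `Λ ≡ 0` on the segment, identity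
  theorem gives `Λ 0 = 0 ≠ 1 = C(-X)`), `false_without_irreducible` (witness `![X^2]`, `y = 3/2`:
  `Ω(n²) = 2Ω(n) ≥ 2ω(n)`, `H_x ≥ ½(log x)^{1/2} - 1 → ∞`), `false_without_pairwise_not_associated` (witness
  `![X, X]`, `y = 29/20`); `conclusion_C_three`: the junk model `![C 3]` (fixed prime divisor) SATISFIES the
  conclusion (`Λ ≡ 0 = C`), so `hasNoFixedPrimeDivisor` is not what a disproof can lean on.
* §4 structure of the conclusion: `Λ_unique` (no ∃-slack: the segment law pins `Λ` on the ball, hence `Λ 0`),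
  `Λ_real_nonneg_of_law` (`Λ(y)` is real `≥ 0` on the segment).
* §5 refuted strengthenings: `not_lsdRealSegment_wide` — the same law on a segment `(5/4, b)` with ANY `b > 2` is
  FALSE for `f = X` (the `p = 2` Euler factor `Σ_v (z/2)^v` has a pole at `2`; single term `n = 2^m`); §5b SHARP:
  `not_lsdRealSegment_upto_two` — already the closed segment `y ≤ 2` fails AT `y = 2` (`H_x(2) ≍ log x → ∞`,
  elementary dyadic/odd-divisor-sum proof `tendsto_omegaNormSum_X_two_atTop`).
* §6 "Why `LSDRealSegment` resists" (docblock, cycle 1).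
* §7 (cycle 2) THE LINEAR RUNG `f = X` IS A THEOREM: `differentiableOn_selbergDelangeOmegaF` (Selberg's Euler product
  `F(1,z) = ∏_p (1 - z/p)⁻¹(1 - 1/p)^z` is holomorphic on `|z| < 2` — new in the tree), `tendsto_normSum_X` /
  `segmentLaw_X` / `conclusion_X` (the crux's conclusion PROVED for `(X)` from the tree's proof
  `MontgomeryVaughan2007_thm_7_18_Omega_holds` of Selberg's theorem — exact calibration of `x⁻¹`, `(log x)^{k(1-y)}`,
  `D^{y-1}`, `Γ^{-k}`, junk terms, and of the pin `Λ 0 = C(X) = 1`), rigidity `eqOn_selbergDelangeOmegaF_of_segmentLaw_X`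
  (every witness `Λ` at `f = X` IS `F(1,·)`; `Λ 0 = 1` forced), the pole `re_selbergDelangeOmegaF_ge`
  (`Re F(1,y) ≥ ¼(1 - y/2)⁻¹` on `[1,2)`), and the refuted strengthening `not_lsdRealSegment_ball`: the crux with
  `ball 0 R`, ANY `R > 2`, is FALSE — the holomorphy radius `2` is sharp (as the segment bound `2` is, §5);
  §7e `conclusion_twoX_add_one`: the first NON-MONIC member `f = 2X + 1` is a theorem too, `Λ(z) = (2 - z)F(1,z)`, pin
  `Λ 0 = 2 = C(2X+1)` (the pin checked at a value `≠ 1`; the pole at `2` cancels — the wall is system-specific).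
* §8 (cycle 2) analysis docblock: the parity content of `Λ(y)` for `Σ deg f_i ≥ 3` or `k ≥ 2` (correction to the route
  rationale), the large-scale numerics (kit jobs j011124 / j011129: linear systems to `10⁹`), why still no kill; `summary₂`.
-/

open Filter Polynomial Finset
open scoped Topology BigOperators

namespace Summit.Parity.BatemanHorn.Cruxes.LSDRealSegment.Disproof

open Literature.NumberTheory.Sieve
open Summit.Parity.BatemanHorn.Theses.SelbergDelangeRigidity
open Summit.Parity.BatemanHorn.Theorems.SystemLSDRealSegment.Negative
open ArithmeticFunction (cardFactors)
open Literature.NumberTheory.LFunctions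
open Literature.NumberTheory.LFunctions.SelbergDelangeOmega

noncomputable section

/-! ## §1 Restatement and bookkeeping -/

/-- The conclusion of the crux for one family `(k, f)`, verbatim. [folklore] -/
def Conclusion (k : ℕ) (f : Fin k → ℤ[X]) : Prop :=
  ∃ Λ : ℂ → ℂ, DifferentiableOn ℂ Λ (Metric.ball 0 2) ∧ Λ 0 = (batemanHornConst f : ℂ) ∧
    ∀ y : ℝ, 5 / 4 < y → y < 7 / 4 → Filter.Tendsto (fun x : ℕ => (x : ℂ)⁻¹ *
      Complex.exp ((k : ℂ) * (1 - (y : ℂ)) * (Real.log (Real.log x) : ℂ)) *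
      ∑ n ∈ Finset.range (x + 1), (y : ℂ) ^ (∑ i, cardFactors (((f i).eval (n : ℤ)).toNat)))
      Filter.atTop (nhds (Λ y * Complex.exp (((y : ℂ) - 1) * (Real.log (∏ i, ((f i).natDegree : ℝ)) : ℂ)) *
        (Complex.Gamma y)⁻¹ ^ k))

/-- The crux is literally `∀ k f, IsBatemanHornSystem f → Conclusion k f`. [folklore] -/
theorem crux_iff : LSDRealSegment ↔ ∀ (k : ℕ) (f : Fin k → ℤ[X]), IsBatemanHornSystem f → Conclusion k f :=
  Iff.rfl

/-- The complex normalised sum of the crux is the real one coerced (positive weights: `y > 0` real, exponents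
in `ℕ`). [folklore] -/
theorem normSum_eq_ofReal (k : ℕ) (f : Fin k → ℤ[X]) (y : ℝ) (x : ℕ) :
    (x : ℂ)⁻¹ * Complex.exp ((k : ℂ) * (1 - (y : ℂ)) * (Real.log (Real.log x) : ℂ)) *
        ∑ n ∈ Finset.range (x + 1), (y : ℂ) ^ (∑ i, cardFactors (((f i).eval (n : ℤ)).toNat)) =
      (((x : ℝ)⁻¹ * Real.exp (k * (1 - y) * Real.log (Real.log x)) *
        ∑ n ∈ Finset.range (x + 1), y ^ (∑ i, cardFactors (((f i).eval (n : ℤ)).toNat)) : ℝ) : ℂ) := by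
  push_cast
  rfl

/-- `ω(n) ≤ Ω(n)` in the form `#primeFactors n ≤ cardFactors n`. [folklore] -/
theorem card_primeFactors_le_cardFactors (n : ℕ) : n.primeFactors.card ≤ cardFactors n := by
  rw [ArithmeticFunction.cardFactors_apply, ← Nat.toFinset_factors]
  exact List.toFinset_card_le _

/-- If `p ∣ ∏ f_i(n) ↔ p ∣ n` for every prime `p` then `ω_f(p) = 1`. [folklore] -/
theorem polyRootCountMod_eq_one' {k : ℕ} {f : Fin k → ℤ[X]}
    (hf : ∀ p : ℕ, p.Prime → ∀ n : ℕ, ((p : ℤ) ∣ ∏ i, (f i).eval (n : ℤ)) ↔ p ∣ n)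
    {p : ℕ} (hp : p.Prime) : polyRootCountMod f p = 1 := by
  unfold polyRootCountMod
  have : ((Finset.range p).filter fun n : ℕ => (p : ℤ) ∣ ∏ i, (f i).eval (n : ℤ)) = {0} := by
    ext n
    simp only [Finset.mem_filter, Finset.mem_range, Finset.mem_singleton, hf p hp]
    constructor
    · rintro ⟨hn, hdvd⟩
      exact Nat.eq_zero_of_dvd_of_lt hdvd hn
    · rintro rfl
      exact ⟨hp.pos, dvd_zero p⟩
  rw [this, Finset.card_singleton]

/-- … then every ordered partial product of a ONE-polynomial family is `1`, so `C(f) = 1`. [folklore] -/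
theorem batemanHornConst_eq_one' {f : Fin 1 → ℤ[X]} (h : ∀ p : ℕ, p.Prime → polyRootCountMod f p = 1) :
    batemanHornConst f = 1 := by
  have hpart : batemanHornPartial f = fun _ => 1 := by
    funext x
    unfold batemanHornPartial
    refine Finset.prod_eq_one fun p hp => ?_
    have hp' := Nat.prime_of_mem_primesLE hp
    have hp0 : (0 : ℝ) < p := by exact_mod_cast hp'.pos
    have hlt : 1 / (p : ℝ) < 1 := by rw [div_lt_one hp0]; exact_mod_cast hp'.one_lt
    rw [h p hp', Fintype.card_fin, pow_one, Nat.cast_one]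
    exact inv_mul_cancel₀ (by linarith)
  rw [batemanHornConst, hpart]
  exact tendsto_const_nhds.limUnder_eq

/-! ## §2 The degenerate instance `k = 0` holds -/

/-- `ω_∅(p) = 0`. [folklore] -/
theorem polyRootCountMod_fin_zero' (f : Fin 0 → ℤ[X]) {p : ℕ} (hp : p.Prime) : polyRootCountMod f p = 0 := by
  unfold polyRootCountMod
  simp only [Finset.univ_eq_empty, Finset.prod_empty, Finset.card_eq_zero, Finset.filter_eq_empty_iff]
  intro n _ h
  exact hp.not_dvd_one (by exact_mod_cast h)

/-- The empty family IS a Bateman–Horn system. [folklore] -/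
theorem isBatemanHornSystem_fin_zero' (f : Fin 0 → ℤ[X]) : IsBatemanHornSystem f where
  irreducible i := i.elim0
  leadingCoeff_pos i := i.elim0
  pairwise_not_associated i := i.elim0
  hasNoFixedPrimeDivisor p hp := by rw [polyRootCountMod_fin_zero' f hp]; exact hp.pos

/-- `C(∅) = 1`. [folklore] -/
theorem batemanHornConst_fin_zero' (f : Fin 0 → ℤ[X]) : batemanHornConst f = 1 := by
  have : batemanHornPartial f = fun _ => 1 := by
    funext x
    unfold batemanHornPartial
    refine Finset.prod_eq_one fun p hp => ?_
    rw [polyRootCountMod_fin_zero' f (Nat.prime_of_mem_primesLE hp)]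
    simp
  rw [batemanHornConst, this]
  exact tendsto_const_nhds.limUnder_eq

/-- `x⁻¹ (x + 1) → 1`. [folklore] -/
theorem tendsto_inv_mul_succ' : Tendsto (fun x : ℕ => (x : ℝ)⁻¹ * (x + 1)) atTop (𝓝 1) := by
  have h : Tendsto (fun x : ℕ => 1 + (x : ℝ)⁻¹) atTop (𝓝 1) := by
    simpa using tendsto_const_nhds.add (tendsto_inv_atTop_nhds_zero_nat (𝕜 := ℝ))
  refine h.congr' ?_
  filter_upwards [eventually_ne_atTop 0] with x hx
  have : (x : ℝ) ≠ 0 := by exact_mod_cast hx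
  field_simp

/-- The `k = 0` instance of `LSDRealSegment` HOLDS with `Λ ≡ 1` (`Ω_∅ ≡ 0`, `H_x = (x+1)/x → 1`, `D = 1`,
`Γ^0 = 1`, `C(∅) = 1`): no refutation can come from the empty system. [folklore] -/
theorem conclusion_fin_zero (f : Fin 0 → ℤ[X]) : Conclusion 0 f := by
  refine ⟨fun _ => 1, differentiableOn_const 1, by rw [batemanHornConst_fin_zero']; simp, fun y _ _ => ?_⟩
  have htarget : (1 : ℂ) * Complex.exp (((y : ℂ) - 1) * (Real.log (∏ i : Fin 0, ((f i).natDegree : ℝ)) : ℂ)) *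
      (Complex.Gamma y)⁻¹ ^ 0 = ((1 : ℝ) : ℂ) := by simp
  rw [htarget]
  have := (Complex.continuous_ofReal.tendsto (1 : ℝ)).comp tendsto_inv_mul_succ'
  refine this.congr fun x => ?_
  simp only [Function.comp_apply, Finset.univ_eq_empty, Finset.sum_empty, pow_zero, Finset.sum_const,
    Finset.card_range, nsmul_eq_mul, mul_one, Nat.cast_zero, zero_mul, Complex.exp_zero]
  push_cast
  ring

/-- … which is literally the `k = 0` case of the route decl. [folklore] -/
example (h : LSDRealSegment) (f : Fin 0 → ℤ[X]) : Conclusion 0 f := h 0 f (isBatemanHornSystem_fin_zero' f)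

/-! ## §3 Load-bearing analysis of `IsBatemanHornSystem` -/

/-- The crux with the field `leadingCoeff_pos` DROPPED. [folklore] -/
def WithoutLeadingCoeffPos : Prop :=
  ∀ (k : ℕ) (f : Fin k → ℤ[X]), (∀ i, Irreducible (f i)) →
    (Pairwise fun i j => ¬Associated (f i) (f j)) → HasNoFixedPrimeDivisor f → Conclusion k f

/-- The crux with the field `irreducible` DROPPED. [folklore] -/
def WithoutIrreducible : Prop :=
  ∀ (k : ℕ) (f : Fin k → ℤ[X]), (∀ i, 0 < (f i).leadingCoeff) →
    (Pairwise fun i j => ¬Associated (f i) (f j)) → HasNoFixedPrimeDivisor f → Conclusion k f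

/-- The crux with the field `pairwise_not_associated` DROPPED. [folklore] -/
def WithoutPairwise : Prop :=
  ∀ (k : ℕ) (f : Fin k → ℤ[X]), (∀ i, Irreducible (f i)) → (∀ i, 0 < (f i).leadingCoeff) →
    HasNoFixedPrimeDivisor f → Conclusion k f

/-- The crux with the field `hasNoFixedPrimeDivisor` DROPPED (status: OPEN, conjecturally TRUE — see
`conclusion_C_three`). [folklore] -/
def WithoutNoFixedPrimeDivisor : Prop :=
  ∀ (k : ℕ) (f : Fin k → ℤ[X]), (∀ i, Irreducible (f i)) → (∀ i, 0 < (f i).leadingCoeff) →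
    (Pairwise fun i j => ¬Associated (f i) (f j)) → Conclusion k f

/-- The crux follows from each weakening (sanity: the `Without…` statements ARE weakenings of the hypothesis). -/
theorem lsdRealSegment_of_without :
    (WithoutLeadingCoeffPos → LSDRealSegment) ∧ (WithoutIrreducible → LSDRealSegment) ∧
      (WithoutPairwise → LSDRealSegment) ∧ (WithoutNoFixedPrimeDivisor → LSDRealSegment) :=
  ⟨fun h k f hf => h k f hf.1 hf.3 hf.4, fun h k f hf => h k f hf.2 hf.3 hf.4,
    fun h k f hf => h k f hf.1 hf.2 hf.4, fun h k f hf => h k f hf.1 hf.2 hf.3⟩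

/-! ### (a) `leadingCoeff_pos` — witness `![-X]` -/

/-- `p ∣ (-X)(n) ↔ p ∣ n`. [folklore] -/
theorem negX_dvd_iff' (p : ℕ) (_hp : p.Prime) (n : ℕ) :
    ((p : ℤ) ∣ ∏ i, ((![-X] : Fin 1 → ℤ[X]) i).eval (n : ℤ)) ↔ p ∣ n := by
  simp [Int.natCast_dvd_natCast]

/-- All values of `-X` on `ℕ` are `≤ 0`, so the typed statistic vanishes identically (`Int.toNat`). [folklore] -/
theorem statΩ_negX (n : ℕ) : (∑ i, cardFactors ((((![-X] : Fin 1 → ℤ[X]) i).eval (n : ℤ)).toNat)) = 0 := by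
  simp

/-- DROP `leadingCoeff_pos` ⇒ FALSE. Witness `k = 1`, `f = ![-X]` (`-X` is prime hence irreducible; `ω(p) = 1 <
p`; pairwise vacuous): `Ω_f ≡ 0`, the normalised sum is `x⁻¹(x+1)(log x)^{1-y} → 0` on the segment, so `Λ ≡ 0`
there (the Γ-factor is non-zero), so `Λ 0 = 0` by the identity theorem — but `C(-X) = 1`. Any proof of the
crux must use positivity of the leading coefficients (through `Int.toNat`). [folklore] -/
theorem false_without_leadingCoeff_pos : ¬WithoutLeadingCoeffPos := by
  intro h
  obtain ⟨Λ, hΛ, hΛ0, hlaw⟩ := h 1 ![-X] (fun i => by simpa using Polynomial.prime_X.neg.irreducible)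
    Subsingleton.pairwise (fun p hp => by rw [polyRootCountMod_eq_one' negX_dvd_iff' hp]; exact hp.one_lt)
  have hvan : ∀ y : ℝ, 5 / 4 < y → y < 7 / 4 → Λ y = 0 := fun y hy hy' => by
    have hlim := (hlaw y hy hy').congr fun x => normSum_eq_ofReal 1 ![-X] y x
    have h0 : Tendsto (fun x : ℕ => (x : ℝ)⁻¹ * Real.exp ((1 : ℕ) * (1 - y) * Real.log (Real.log x)) *
        ∑ n ∈ Finset.range (x + 1), y ^ (∑ i, cardFactors ((((![-X] : Fin 1
            → ℤ[X]) i).eval (n : ℤ)).toNat))) atTop (𝓝 0) := by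
      refine (tendsto_zero_of_const_sum le_rfl (by linarith : (1 : ℝ) < y) 1).congr fun x => ?_
      simp
    have := eq_zero_of_tendsto_ofReal hlim h0
    rw [mul_assoc] at this
    exact (mul_eq_zero.1 this).resolve_right (gammaFactor_ne_zero 1 _ (by linarith))
  have h0 := apply_zero_eq_zero_of_vanish hΛ hvan
  rw [hΛ0, batemanHornConst_eq_one' fun p hp => polyRootCountMod_eq_one' negX_dvd_iff' hp] at h0
  simp at h0

/-! ### (b) `irreducible` — witness `![X ^ 2]` -/

/-- `p ∣ n² ↔ p ∣ n`. [folklore] -/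
theorem sq_dvd_iff' (p : ℕ) (hp : p.Prime) (n : ℕ) :
    ((p : ℤ) ∣ ∏ i, ((![X ^ 2] : Fin 1 → ℤ[X]) i).eval (n : ℤ)) ↔ p ∣ n := by
  simp only [Fin.prod_univ_one, Matrix.cons_val_fin_one, eval_pow, eval_X]
  rw [← Nat.cast_pow, Int.natCast_dvd_natCast]
  exact hp.prime.dvd_pow_iff_dvd two_ne_zero

/-- NO cap: `Ω_{![X²]}(n) = Ω(n²) = 2 Ω(n)`. [folklore] -/
theorem statΩ_sq (n : ℕ) :
    (∑ i, cardFactors ((((![X ^ 2] : Fin 1 → ℤ[X]) i).eval (n : ℤ)).toNat)) = 2 * cardFactors n := by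
  simp only [Fin.sum_univ_one, Matrix.cons_val_fin_one, eval_pow, eval_X]
  rw [← Nat.cast_pow, Int.toNat_natCast, ArithmeticFunction.cardFactors_pow]

/-- `2^{ω(n)} ≤ y^{2 Ω(n)}` once `y² ≥ 2` (and `y ≥ 0`). [folklore] -/
theorem two_pow_omega_le {y : ℝ} (hy : 2 ≤ y ^ 2) (n : ℕ) :
    (2 : ℝ) ^ n.primeFactors.card ≤ y ^ (2 * cardFactors n) :=
  calc (2 : ℝ) ^ n.primeFactors.card ≤ (2 : ℝ) ^ cardFactors n :=
        pow_le_pow_right₀ (by norm_num) (card_primeFactors_le_cardFactors n)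
    _ ≤ (y ^ 2) ^ cardFactors n := pow_le_pow_left₀ (by norm_num) hy _
    _ = y ^ (2 * cardFactors n) := (pow_mul y 2 _).symm

/-- `Σ_{n ≤ x} y^{Ω(n²)} ≥ (x/2) log x - x` once `y² ≥ 2`. [folklore] -/
theorem sum_statΩ_sq_ge {y : ℝ} (hy : 2 ≤ y ^ 2) (hy0 : 0 ≤ y) (x : ℕ) :
    (x : ℝ) / 2 * Real.log x - x ≤ ∑ n ∈ Finset.range (x + 1), y ^ (∑ i, cardFactors ((((![X ^ 2] : Fin 1
        → ℤ[X]) i).eval (n : ℤ)).toNat)) := by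
  refine (sum_two_pow_omega_ge x).trans ?_
  calc ∑ n ∈ Icc 1 x, (2 : ℝ) ^ n.primeFactors.card
      ≤ ∑ n ∈ Icc 1 x, y ^ (∑ i, cardFactors ((((![X ^ 2] : Fin 1 → ℤ[X]) i).eval (n : ℤ)).toNat)) := by
        refine Finset.sum_le_sum fun n _ => ?_
        rw [statΩ_sq]
        exact two_pow_omega_le hy n
    _ ≤ ∑ n ∈ Finset.range (x + 1), y ^ (∑ i, cardFactors ((((![X ^ 2] : Fin 1
        → ℤ[X]) i).eval (n : ℤ)).toNat)) :=
        Finset.sum_le_sum_of_subset_of_nonneg (fun n hn => by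
          simp only [Finset.mem_Icc, Finset.mem_range] at hn ⊢; omega) fun _ _ _ => by positivity

/-- DROP `irreducible` ⇒ FALSE. Witness `k = 1`, `f = ![X²]` (leading coefficient `1 > 0`, `ω(p) = 1 < p`,
`C(X²) = 1`): `Ω(n²) = 2Ω(n) ≥ 2ω(n)`, so at `y = 3/2` (`y² = 9/4 ≥ 2`, `k(y-1) = 1/2 < 1`) the normalised sum is
`≥ ½ (log x)^{1/2} - 1 → +∞`: no limit exists, whatever `Λ`. (Conjecturally `Σ_{n≤x} y^{2Ω(n)} ≍ x(log x)^{y²-1}`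
for `y² < 2` too, so EVERY `y > φ^{1/2}·…` — precisely every `y` with `y² - 1 > y - 1`, i.e. every `y > 1` — breaks
the `(log x)^{y-1}` normalisation; the crude divisor bound certifies it for `y ≥ √2`.) [folklore] -/
theorem false_without_irreducible : ¬WithoutIrreducible := by
  intro h
  obtain ⟨Λ, _, _, hlaw⟩ := h 1 ![X ^ 2] (fun i => by simp) Subsingleton.pairwise
    (fun p hp => by rw [polyRootCountMod_eq_one' sq_dvd_iff' hp]; exact hp.one_lt)
  have hlim := (hlaw (3 / 2) (by norm_num) (by norm_num)).congr fun x => normSum_eq_ofReal 1 ![X ^ 2] (3 / 2) x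
  refine not_tendsto_ofReal_of_tendsto_atTop ?_ _ hlim
  exact tendsto_atTop_of_lower_envelope (by norm_num) (by norm_num)
    fun x _ => sum_statΩ_sq_ge (by norm_num) (by norm_num) x

/-! ### (c) `pairwise_not_associated` — witness `![X, X]` -/

/-- `p ∣ n·n ↔ p ∣ n`. [folklore] -/
theorem pair_dvd_iff' (p : ℕ) (hp : p.Prime) (n : ℕ) :
    ((p : ℤ) ∣ ∏ i, ((![X, X] : Fin 2 → ℤ[X]) i).eval (n : ℤ)) ↔ p ∣ n := by
  simp only [Fin.prod_univ_two, Matrix.cons_val_zero, Matrix.cons_val_one, eval_X]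
  rw [← Nat.cast_mul, Int.natCast_dvd_natCast]
  constructor
  · intro h2; rcases hp.dvd_mul.1 h2 with h2 | h2 <;> exact h2
  · intro h2; exact dvd_mul_of_dvd_left h2 n

/-- `Ω_{![X,X]}(n) = 2 Ω(n)`. [folklore] -/
theorem statΩ_pair (n : ℕ) :
    (∑ i, cardFactors ((((![X, X] : Fin 2 → ℤ[X]) i).eval (n : ℤ)).toNat)) = 2 * cardFactors n := by
  simp only [Fin.sum_univ_two, Matrix.cons_val_zero, Matrix.cons_val_one, eval_X, Int.toNat_natCast]
  ring

/-- `Σ_{n ≤ x} y^{Ω(n)+Ω(n)} ≥ (x/2) log x - x` once `y² ≥ 2`. [folklore] -/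
theorem sum_statΩ_pair_ge {y : ℝ} (hy : 2 ≤ y ^ 2) (hy0 : 0 ≤ y) (x : ℕ) :
    (x : ℝ) / 2 * Real.log x - x ≤ ∑ n ∈ Finset.range (x + 1), y ^ (∑ i, cardFactors ((((![X, X] : Fin 2
        → ℤ[X]) i).eval (n : ℤ)).toNat)) := by
  refine (sum_two_pow_omega_ge x).trans ?_
  calc ∑ n ∈ Icc 1 x, (2 : ℝ) ^ n.primeFactors.card
      ≤ ∑ n ∈ Icc 1 x, y ^ (∑ i, cardFactors ((((![X, X] : Fin 2 → ℤ[X]) i).eval (n : ℤ)).toNat)) := by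
        refine Finset.sum_le_sum fun n _ => ?_
        rw [statΩ_pair]
        exact two_pow_omega_le hy n
    _ ≤ ∑ n ∈ Finset.range (x + 1), y ^ (∑ i, cardFactors ((((![X, X] : Fin 2
        → ℤ[X]) i).eval (n : ℤ)).toNat)) :=
        Finset.sum_le_sum_of_subset_of_nonneg (fun n hn => by
          simp only [Finset.mem_Icc, Finset.mem_range] at hn ⊢; omega) fun _ _ _ => by positivity

/-- DROP `pairwise_not_associated` ⇒ FALSE. Witness `k = 2`, `f = ![X, X]` (both irreducible, leading
coefficient `1`, `ω(p) = 1 < p`; NB `C(X, X) = ∏_p (1-1/p)^{-1} = +∞`, so `batemanHornConst` is junk and the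
refutation must come from DIVERGENCE): `Ω_f = 2Ω(n) ≥ 2ω(n)`, so at `y = 29/20` (`y² = 841/400 ≥ 2`,
`k(y-1) = 9/10 < 1`) the normalised sum is `≥ ½ (log x)^{1/10} - 1 → +∞`. [folklore] -/
theorem false_without_pairwise_not_associated : ¬WithoutPairwise := by
  intro h
  obtain ⟨Λ, _, _, hlaw⟩ := h 2 ![X, X]
    (fun i => by fin_cases i <;> simpa using Polynomial.prime_X.irreducible)
    (fun i => by fin_cases i <;> simp)
    (fun p hp => by rw [polyRootCountMod_eq_one' pair_dvd_iff' hp]; exact hp.one_lt)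
  have hlim := (hlaw (29 / 20) (by norm_num) (by norm_num)).congr fun x => normSum_eq_ofReal 2 ![X, X] (29 / 20) x
  refine not_tendsto_ofReal_of_tendsto_atTop ?_ _ hlim
  exact tendsto_atTop_of_lower_envelope (by norm_num) (by norm_num)
    fun x _ => sum_statΩ_pair_ge (by norm_num) (by norm_num) x

/-! ### (d) `hasNoFixedPrimeDivisor` is NOT load-bearing — the junk model `![C 3]`

With `hasNoFixedPrimeDivisor` dropped the crux is (conjecturally) STILL TRUE: a fixed prime divisor `p₀` kills the
Euler factor at `0` on both sides (`E_{p₀}(0) = P(p₀ ∤ ∏ f_i(n)) = 0`, and the partial products of `C(f)` contain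
`1 - p₀/p₀ = 0`), so `Λ(0) = 0 = C(f)` consistently while the segment law keeps its shape. The junk model `![C 3]`
satisfies the three other fields, violates `hasNoFixedPrimeDivisor`, and SATISFIES the conclusion. -/

/-- `![C 3]` has the fixed prime divisor `3`: `ω(3) = 3`. [folklore] -/
theorem polyRootCountMod_C_three' : polyRootCountMod ![(C 3 : ℤ[X])] 3 = 3 := by
  unfold polyRootCountMod
  simp

/-- … hence it is NOT a Bateman–Horn system, [folklore] -/
theorem not_hasNoFixedPrimeDivisor_C_three' : ¬HasNoFixedPrimeDivisor ![(C 3 : ℤ[X])] := fun h => by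
  have := h 3 Nat.prime_three
  rw [polyRootCountMod_C_three'] at this
  exact lt_irrefl _ this

/-- … although it satisfies the three other fields, [folklore] -/
theorem C_three_other_fields' :
    (∀ i, Irreducible ((![(C 3 : ℤ[X])]) i)) ∧ (∀ i, 0 < ((![(C 3 : ℤ[X])]) i).leadingCoeff) ∧
      Pairwise fun i j => ¬Associated ((![(C 3 : ℤ[X])]) i) ((![(C 3 : ℤ[X])]) j) := by
  refine ⟨fun i => ?_, fun i => ?_, Subsingleton.pairwise⟩
  · simpa using (Polynomial.prime_C_iff.2 Int.prime_three).irreducible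
  · simp only [Matrix.cons_val_fin_one, leadingCoeff_C]
    norm_num

/-- … its Bateman–Horn constant is `0` (the partial products vanish from `x = 3` on), [folklore] -/
theorem batemanHornConst_C_three' : batemanHornConst ![(C 3 : ℤ[X])] = 0 := by
  refine HasBatemanHornConst.batemanHornConst_eq ?_
  refine (tendsto_const_nhds (x := (0 : ℝ))).congr' ?_
  filter_upwards [eventually_ge_atTop 3] with x hx
  unfold batemanHornPartial
  symm
  refine Finset.prod_eq_zero (i := 3) (by simp [Nat.mem_primesLE, hx, Nat.prime_three]) ?_
  rw [polyRootCountMod_C_three']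
  norm_num

/-- … its statistic is the constant `1` (`Ω(3) = 1`), [folklore] -/
theorem statΩ_C_three (n : ℕ) :
    (∑ i, cardFactors ((((![(C 3 : ℤ[X])] : Fin 1 → ℤ[X]) i).eval (n : ℤ)).toNat)) = 1 := by
  simp only [Fin.sum_univ_one, Matrix.cons_val_fin_one, eval_C]
  rw [show ((3 : ℤ)).toNat = 3 from rfl]
  exact ArithmeticFunction.cardFactors_apply_prime Nat.prime_three

/-- … and it SATISFIES the conclusion of the crux with `Λ ≡ 0` (the normalised sum is `x⁻¹(x+1)(log x)^{1-y} y → 0`,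
`C = 0`; `natDegree (C 3) = 0` enters only through `log 0 = 0`). So no refutation of the crux can come from a
fixed prime divisor alone. [folklore] -/
theorem conclusion_C_three : Conclusion 1 ![(C 3 : ℤ[X])] := by
  refine ⟨fun _ => 0, differentiableOn_const 0, by rw [batemanHornConst_C_three']; simp, fun y hy _ => ?_⟩
  rw [zero_mul, zero_mul]
  have h0 := tendsto_ofReal_of_tendsto (tendsto_zero_of_const_sum le_rfl (by linarith : (1 : ℝ) < y) y)
  rw [Complex.ofReal_zero] at h0
  refine h0.congr fun x => ?_
  rw [normSum_eq_ofReal 1 _ y x]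
  congr 1
  simp only [statΩ_C_three, pow_one, Finset.sum_const, Finset.card_range, nsmul_eq_mul]
  push_cast
  ring

/-- Hence `WithoutNoFixedPrimeDivisor` is NOT refuted by the fixed-divisor junk model: at `![C 3]` it holds. -/
theorem withoutNoFixedPrimeDivisor_at_C_three :
    (∀ i, Irreducible ((![(C 3 : ℤ[X])]) i)) ∧ (∀ i, 0 < ((![(C 3 : ℤ[X])]) i).leadingCoeff) ∧
      (Pairwise fun i j => ¬Associated ((![(C 3 : ℤ[X])]) i) ((![(C 3 : ℤ[X])]) j)) ∧
      ¬HasNoFixedPrimeDivisor ![(C 3 : ℤ[X])] ∧ Conclusion 1 ![(C 3 : ℤ[X])] :=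
  ⟨C_three_other_fields'.1, C_three_other_fields'.2.1, C_three_other_fields'.2.2,
    not_hasNoFixedPrimeDivisor_C_three', conclusion_C_three⟩

/-! ## §4 Structure of the conclusion: what the segment law forces on `Λ` -/

/-- The real-segment law of the crux for a given `(k, f, Λ)` (third conjunct of `Conclusion`, limit re-associated).
[folklore] -/
def SegmentLaw (k : ℕ) (f : Fin k → ℤ[X]) (Λ : ℂ → ℂ) : Prop :=
  ∀ y : ℝ, 5 / 4 < y → y < 7 / 4 → Tendsto (fun x : ℕ => (x : ℂ)⁻¹ *
      Complex.exp ((k : ℂ) * (1 - (y : ℂ)) * (Real.log (Real.log x) : ℂ)) *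
      ∑ n ∈ Finset.range (x + 1), (y : ℂ) ^ (∑ i, cardFactors (((f i).eval (n : ℤ)).toNat))) atTop
    (𝓝 (Λ y * (Complex.exp (((y : ℂ) - 1) * (Real.log (∏ i, ((f i).natDegree : ℝ)) : ℂ)) *
      (Complex.Gamma y)⁻¹ ^ k)))

/-- `Conclusion k f ↔ ∃ Λ` holomorphic on the ball with `Λ 0 = C(f)` and `SegmentLaw k f Λ`. [folklore] -/
theorem conclusion_iff (k : ℕ) (f : Fin k → ℤ[X]) : Conclusion k f ↔
    ∃ Λ : ℂ → ℂ, DifferentiableOn ℂ Λ (Metric.ball 0 2) ∧ Λ 0 = (batemanHornConst f : ℂ) ∧ SegmentLaw k f Λ := by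
  simp only [Conclusion, SegmentLaw, mul_assoc]

/-- UNIQUENESS: two `Λ`'s holomorphic on `|z| < 2` satisfying the segment law for the same `(k, f)` coincide on
`ball 0 2` (limits are unique, the Γ-factor is non-zero, identity theorem). So the `∃ Λ` of the crux has no slack:
the clause `Λ 0 = batemanHornConst f` asserts that the ANALYTIC CONTINUATION to `0` of
`y ↦ (lim H_x(y)) Γ(y)^k D^{1-y}` is the singular series. [folklore] -/
theorem Λ_unique {k : ℕ} {f : Fin k → ℤ[X]} {Λ₁ Λ₂ : ℂ → ℂ}
    (h₁ : DifferentiableOn ℂ Λ₁ (Metric.ball 0 2)) (h₂ : DifferentiableOn ℂ Λ₂ (Metric.ball 0 2))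
    (l₁ : SegmentLaw k f Λ₁) (l₂ : SegmentLaw k f Λ₂) : Set.EqOn Λ₁ Λ₂ (Metric.ball 0 2) := by
  refine eqOn_ball_of_eqOn_segment h₁ h₂ fun y hy hy' => ?_
  have := tendsto_nhds_unique (l₁ y hy hy') (l₂ y hy hy')
  exact mul_right_cancel₀ (gammaFactor_ne_zero k _ (by linarith)) this

/-- WITHOUT HOLOMORPHY THE `Λ 0`-CLAUSE IS VACUOUS: `update Λ 0 c` satisfies the same segment law for every `c`
(`0 ∉ (5/4, 7/4)`). [folklore] -/
theorem segmentLaw_update_zero {k : ℕ} {f : Fin k → ℤ[X]} {Λ : ℂ → ℂ} (hlaw : SegmentLaw k f Λ) (c : ℂ) :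
    Function.update Λ 0 c 0 = c ∧ SegmentLaw k f (Function.update Λ 0 c) := by
  refine ⟨Function.update_self .., fun y hy hy' => ?_⟩
  have hy0 : (y : ℂ) ≠ 0 := by exact_mod_cast (show y ≠ 0 by linarith)
  rw [Function.update_of_ne hy0]
  exact hlaw y hy hy'

/-- The archimedean factor is a POSITIVE REAL number at real `y > 0`. [folklore] -/
theorem gammaFactor_ofReal' (k : ℕ) (f : Fin k → ℤ[X]) {y : ℝ} (hy : 0 < y) :
    ∃ e : ℝ, 0 < e ∧ (Complex.exp (((y : ℂ) - 1) * (Real.log (∏ i, ((f i).natDegree : ℝ)) : ℂ))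
        * (Complex.Gamma y)⁻¹ ^ k) = (e : ℂ) := by
  refine ⟨Real.exp ((y - 1) * Real.log (∏ i, ((f i).natDegree : ℝ))) * (Real.Gamma y)⁻¹ ^ k, ?_, ?_⟩
  · have := Real.Gamma_pos_of_pos hy
    positivity
  · rw [Complex.Gamma_ofReal]
    push_cast
    ring

/-- The complex normalised sum is a NON-NEGATIVE REAL number (positive weights). [folklore] -/
theorem normSum_ofReal_nonneg (k : ℕ) (f : Fin k → ℤ[X]) {y : ℝ} (hy : 0 ≤ y) (x : ℕ) :
    ∃ r : ℝ, 0 ≤ r ∧ ((x : ℂ)⁻¹ * Complex.exp ((k : ℂ) * (1 - (y : ℂ)) * (Real.log (Real.log x) : ℂ))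
        * ∑ n ∈ Finset.range (x + 1), (y : ℂ) ^ (∑ i, cardFactors (((f i).eval (n : ℤ)).toNat))) = (r : ℂ) := by
  refine ⟨(x : ℝ)⁻¹ * Real.exp (k * (1 - y) * Real.log (Real.log x)) * ∑ n ∈ Finset.range (x + 1), y
      ^ (∑ i, cardFactors (((f i).eval (n : ℤ)).toNat)), ?_, (normSum_eq_ofReal k f y x)⟩
  have : 0 ≤ ∑ n ∈ Finset.range (x + 1), y ^ (∑ i, cardFactors (((f i).eval (n : ℤ)).toNat)) :=
    Finset.sum_nonneg fun _ _ => pow_nonneg hy _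
  positivity

/-- POSITIVITY PASSES TO THE LIMIT: the segment law forces `Λ(y)` to be REAL and `≥ 0` at every
`y ∈ (5/4, 7/4)`. (Strict positivity is NOT forced by soft arguments: an isolated zero of `Λ` on the segment is
compatible with positive weights; conjecturally `λ_f(y) > 0` for `y > 0`.) [folklore] -/
theorem Λ_real_nonneg_of_law {k : ℕ} {f : Fin k → ℤ[X]} {Λ : ℂ → ℂ} (hlaw : SegmentLaw k f Λ)
    {y : ℝ} (hy : 5 / 4 < y) (hy' : y < 7 / 4) : (Λ y).im = 0 ∧ 0 ≤ (Λ y).re := by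
  obtain ⟨e, he, hE⟩ := gammaFactor_ofReal' k f (by linarith : (0 : ℝ) < y)
  have hlim := hlaw y hy hy'
  rw [hE] at hlim
  choose r hr0 hr using fun x => normSum_ofReal_nonneg k f (by linarith : (0 : ℝ) ≤ y) x
  have hlim' : Tendsto (fun x : ℕ => ((r x : ℝ) : ℂ)) atTop (𝓝 (Λ y * e)) := hlim.congr hr
  have hre : Tendsto r atTop (𝓝 (Λ y * e).re) := tendsto_re_of_tendsto_ofReal hlim'
  have him : (Λ y * e).im = 0 := by
    have h1 := (Complex.continuous_im.tendsto _).comp hlim'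
    have h2 : Tendsto (fun x : ℕ => (((r x : ℝ) : ℂ)).im) atTop (𝓝 0) := by simp
    exact tendsto_nhds_unique h1 h2
  have hre0 : 0 ≤ (Λ y * e).re := ge_of_tendsto' hre hr0
  rw [Complex.mul_im, Complex.ofReal_re, Complex.ofReal_im, mul_zero, zero_add] at him
  rw [Complex.mul_re, Complex.ofReal_re, Complex.ofReal_im, mul_zero, sub_zero] at hre0
  exact ⟨(mul_eq_zero.1 him).resolve_right he.ne', (mul_nonneg_iff_of_pos_right he).1 hre0⟩

/-- SCHWARZ SYMMETRY: a `Λ` holomorphic on `|z| < 2` and real on the segment satisfies `Λ(conj z) = conj Λ(z)`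
on the ball. [folklore] -/
theorem Λ_conj_symm' {Λ : ℂ → ℂ} (hΛ : DifferentiableOn ℂ Λ (Metric.ball 0 2))
    (hreal : ∀ y : ℝ, 5 / 4 < y → y < 7 / 4 → (Λ y).im = 0) :
    Set.EqOn Λ (fun z => starRingEnd ℂ (Λ (starRingEnd ℂ z))) (Metric.ball 0 2) := by
  have hball : ∀ z : ℂ, z ∈ Metric.ball (0 : ℂ) 2 → starRingEnd ℂ z ∈ Metric.ball (0 : ℂ) 2 := fun z hz => by
    simpa [Metric.mem_ball, dist_zero_right, Complex.norm_conj] using hz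
  have h₂ : DifferentiableOn ℂ (fun z => starRingEnd ℂ (Λ (starRingEnd ℂ z))) (Metric.ball 0 2) := by
    intro z hz
    have hd : DifferentiableAt ℂ Λ (starRingEnd ℂ z) :=
      (hΛ _ (hball z hz)).differentiableAt (Metric.isOpen_ball.mem_nhds (hball z hz))
    have h2 := hd.conj_conj
    rw [Complex.conj_conj] at h2
    exact h2.differentiableWithinAt
  refine eqOn_ball_of_eqOn_segment hΛ h₂ fun y hy hy' => ?_
  simp only [Complex.conj_ofReal]
  exact (Complex.conj_eq_iff_im.2 (hreal y hy hy')).symm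

/-- Consequence: under the segment law a `Λ` holomorphic on `|z| < 2` is REAL on the whole diameter `(-2, 2)` — in
particular the pinned value `Λ 0` is real, as `batemanHornConst f` is, and so are all Taylor coefficients of `Λ`
at `0` (the data the route extracts). [folklore] -/
theorem Λ_real_on_diameter {k : ℕ} {f : Fin k → ℤ[X]} {Λ : ℂ → ℂ} (hΛ : DifferentiableOn ℂ Λ (Metric.ball 0 2))
    (hlaw : SegmentLaw k f Λ) {t : ℝ} (ht : |t| < 2) : (Λ t).im = 0 := by
  have hsym := Λ_conj_symm' hΛ fun y hy hy' => (Λ_real_nonneg_of_law hlaw hy hy').1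
  have hmem : ((t : ℝ) : ℂ) ∈ Metric.ball (0 : ℂ) 2 := by
    simpa [Metric.mem_ball, dist_zero_right, Complex.norm_real] using ht
  have := hsym hmem
  simp only [Complex.conj_ofReal] at this
  exact Complex.conj_eq_iff_im.1 this.symm

/-! ## §5 Refuted strengthenings: the wall at `y = 2`

For the un-capped `Ω` the `p = 2` local factor of the conjectural `λ_f` is `E_2(z) = Σ_v P(v_2 = v) z^v`, radius of
convergence EXACTLY `2` for `f = X` (`E_2(z) = (1 - 1/2)/(1 - z/2)`), so the law cannot survive on a real segment
reaching past `2`: along `x = 2^m` the single term `n = 2^m` already gives `H_x(y) ≥ (y/2)^m (m log 2)^{1-y} → ∞` for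
`y > 2`. Below: the crux with `7/4` replaced by ANY `b > 2` is false (witness the Bateman–Horn system `![X]`).
The OPEN segment `(5/4, 2)` is conjecturally still fine; AT `y = 2`, `H_x(2) = Σ_{n≤x} 2^{Ω(n)}/(x log x) ≍ log x`
diverges as well (Grosswald / Tenenbaum II.6): the CLOSED segment `5/4 < y ≤ 2` fails at its endpoint — proved in §5b
(`tendsto_omegaNormSum_X_two_atTop`, `not_lsdRealSegment_upto_two`) by an elementary second-logarithm argument
(dyadic pieces `2^j ·` odd, odd divisor sums `Σ_{m≤M odd} d(m) ≥ (M/4) log M - 2M`). So the law lives EXACTLY on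
`y < 2`, and any proof of the crux must use `y < 2` in an essential way. -/

/-- `Ω(2^m) = m` for the family `![X]`. [folklore] -/
theorem statΩ_X_two_pow (m : ℕ) :
    (∑ i, cardFactors ((((![X] : Fin 1 → ℤ[X]) i).eval ((2 ^ m : ℕ) : ℤ)).toNat)) = m := by
  simp only [Fin.sum_univ_one, Matrix.cons_val_fin_one, eval_X, Int.toNat_natCast]
  exact ArithmeticFunction.cardFactors_apply_prime_pow Nat.prime_two

/-- Lower bound along `x = 2^m` for `2 < y < 4`: the real Ω-normalised sum of `![X]` is `≥ (y/2)^m / (m log 2)^3`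
(keep the single term `n = 2^m`; `(log 2^m)^{1-y} = (m log 2)^{1-y} ≥ (m log 2)^{-3}`). [folklore] -/
theorem omegaSum_X_two_pow_ge_gen {y : ℝ} (hy2 : 2 < y) (hy4 : y < 4) {m : ℕ} (hm : 2 ≤ m) :
    (y / 2) ^ m / ((m : ℝ) * Real.log 2) ^ 3 ≤
      ((2 ^ m : ℕ) : ℝ)⁻¹ * Real.exp ((1 : ℕ) * (1 - y) * Real.log (Real.log ((2 ^ m : ℕ) : ℝ))) *
        ∑ n ∈ Finset.range (2 ^ m + 1), y ^ (∑ i, cardFactors ((((![X] : Fin 1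
            → ℤ[X]) i).eval (n : ℤ)).toNat)) := by
  have hlog2 : (1 : ℝ) / 2 < Real.log 2 := by have := Real.log_two_gt_d9; linarith
  have hm' : (2 : ℝ) ≤ m := by exact_mod_cast hm
  have ht : 1 ≤ (m : ℝ) * Real.log 2 := by nlinarith
  have ht0 : 0 < (m : ℝ) * Real.log 2 := by linarith
  have hlogpow : Real.log ((2 ^ m : ℕ) : ℝ) = m * Real.log 2 := by push_cast; rw [Real.log_pow]
  have hexp : Real.exp ((1 : ℕ) * (1 - y) * Real.log (Real.log ((2 ^ m : ℕ) : ℝ))) =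
      ((m : ℝ) * Real.log 2) ^ (1 - y) := by
    rw [hlogpow, Real.rpow_def_of_pos ht0]
    congr 1
    push_cast
    ring
  have hexp_ge : (((m : ℝ) * Real.log 2) ^ 3)⁻¹ ≤ ((m : ℝ) * Real.log 2) ^ (1 - y) := by
    rw [← Real.rpow_natCast, ← Real.rpow_neg ht0.le]
    exact Real.rpow_le_rpow_of_exponent_le ht (by push_cast; linarith)
  have hsum : y ^ m ≤ ∑ n ∈ Finset.range (2 ^ m + 1), y ^ (∑ i, cardFactors ((((![X] : Fin 1
      → ℤ[X]) i).eval (n : ℤ)).toNat)) := by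
    have e := statΩ_X_two_pow m
    have hy0 : 0 ≤ y := by linarith
    have := Finset.single_le_sum (f := fun n : ℕ => y ^ (∑ i, cardFactors ((((![X] : Fin 1
        → ℤ[X]) i).eval (n : ℤ)).toNat)))
      (fun _ _ => by positivity) (Finset.mem_range.2 (Nat.lt_succ_self (2 ^ m)))
    rwa [e] at this
  have hx : ((2 ^ m : ℕ) : ℝ)⁻¹ = (1 / 2 : ℝ) ^ m := by push_cast; simp
  have hy0 : 0 ≤ y := by linarith
  calc (y / 2) ^ m / ((m : ℝ) * Real.log 2) ^ 3
      = (1 / 2 : ℝ) ^ m * (((m : ℝ) * Real.log 2) ^ 3)⁻¹ * y ^ m := by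
        rw [div_eq_mul_inv, show y / 2 = 1 / 2 * y by ring, mul_pow]; ring
    _ ≤ (1 / 2 : ℝ) ^ m * ((m : ℝ) * Real.log 2) ^ (1 - y) *
          ∑ n ∈ Finset.range (2 ^ m + 1), y ^ (∑ i, cardFactors ((((![X] : Fin 1
              → ℤ[X]) i).eval (n : ℤ)).toNat)) := by
        gcongr
    _ = _ := by rw [hx, hexp]

/-- `(y/2)^m / (m log 2)^3 → ∞` for `y > 2`. [folklore] -/
theorem tendsto_geom_div_cube {y : ℝ} (hy2 : 2 < y) :
    Tendsto (fun m : ℕ => (y / 2) ^ m / ((m : ℝ) * Real.log 2) ^ 3) atTop atTop := by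
  have hr : 1 < y / 2 := by linarith
  have h0 : Tendsto (fun m : ℕ => (m : ℝ) ^ 3 / (y / 2) ^ m) atTop (𝓝[>] 0) := by
    refine tendsto_nhdsWithin_iff.2 ⟨tendsto_pow_const_div_const_pow_of_one_lt 3 hr, ?_⟩
    filter_upwards [eventually_ge_atTop 1] with m hm
    simp only [Set.mem_Ioi]
    positivity
  have h1 := h0.inv_tendsto_nhdsGT_zero
  have h2 := h1.const_mul_atTop (by have := Real.log_two_gt_d9; positivity : (0 : ℝ) < (Real.log 2 ^ 3)⁻¹)
  refine h2.congr' ?_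
  filter_upwards [eventually_ge_atTop 1] with m hm
  have hm0 : (m : ℝ) ≠ 0 := by exact_mod_cast (show m ≠ 0 by omega)
  have hl : Real.log 2 ≠ 0 := by have := Real.log_two_gt_d9; positivity
  have hy0 : y / 2 ≠ 0 := by positivity
  simp only [Pi.inv_apply]
  field_simp

/-- THE LAW ON ANY SEGMENT REACHING PAST 2 IS FALSE: the crux with `7/4` replaced by any `b > 2` (everything else —
the ball `|z| < 2`, `Λ 0 = C(f)` — unchanged) fails. Witness `k = 1`, `f = ![X]` (a Bateman–Horn system) and
`y = min ((2+b)/2) 3 ∈ (2, b)`: along `x = 2^m`, `H_x(y) ≥ (y/2)^m/(m log 2)^3 → ∞`. So the margin `7/4 < 2` of the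
crux is ESSENTIAL for the un-capped `Ω` (contrast: the capped sibling `SystemLSDRealSegment` has polynomial local
factors and no wall). [folklore] -/
theorem not_lsdRealSegment_wide {b : ℝ} (hb : 2 < b) :
    ¬ ∀ (k : ℕ) (f : Fin k → ℤ[X]), IsBatemanHornSystem f → ∃ Λ : ℂ → ℂ, DifferentiableOn ℂ Λ (Metric.ball 0 2) ∧
      Λ 0 = (batemanHornConst f : ℂ) ∧ ∀ y : ℝ, 5 / 4 < y → y < b →
        Filter.Tendsto (fun x : ℕ => (x : ℂ)⁻¹
            * Complex.exp ((k : ℂ) * (1 - (y : ℂ)) * (Real.log (Real.log x) : ℂ)) *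
          ∑ n ∈ Finset.range (x + 1), (y : ℂ) ^ (∑ i, cardFactors (((f i).eval (n : ℤ)).toNat))) Filter.atTop
          (nhds (Λ y * Complex.exp (((y : ℂ) - 1) * (Real.log (∏ i, ((f i).natDegree : ℝ)) : ℂ)) *
            (Complex.Gamma y)⁻¹ ^ k)) := by
  intro h
  obtain ⟨Λ, _, _, hlaw⟩ := h 1 ![X] isBatemanHornSystem_X
  set y : ℝ := min ((2 + b) / 2) 3 with hy
  have hy2 : 2 < y := by rw [hy]; exact lt_min (by linarith) (by norm_num)
  have hy4 : y < 4 := by rw [hy]; exact (min_le_right _ _).trans_lt (by norm_num)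
  have hyb : y < b := by rw [hy]; exact (min_le_left _ _).trans_lt (by linarith)
  have hlim := (hlaw y (by linarith) hyb).congr fun x => normSum_eq_ofReal 1 ![X] y x
  have hre := tendsto_re_of_tendsto_ofReal hlim
  have h2m : Tendsto (fun m : ℕ => 2 ^ m) atTop atTop := tendsto_pow_atTop_atTop_of_one_lt one_lt_two
  refine not_tendsto_atTop_of_tendsto_nhds (hre.comp h2m) ?_
  refine tendsto_atTop_mono' atTop ?_ (tendsto_geom_div_cube hy2)
  filter_upwards [eventually_ge_atTop 2] with m hm
  exact omegaSum_X_two_pow_ge_gen hy2 hy4 hm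

/-! ### §5b The endpoint `y = 2` itself (sharp wall): `H_x(2) → +∞` for `f = X`

Step 1: `d(n) ≤ 2^{Ω(n)}` and `Ω(2^j m) = j + Ω(m)` -/

/-- `d(n) ≤ 2^{Ω(n)}` (`v + 1 ≤ 2^v` prime by prime). [folklore] -/
theorem card_divisors_le_two_pow_cardFactors {n : ℕ} (hn : n ≠ 0) : n.divisors.card ≤ 2 ^ cardFactors n := by
  rw [Nat.card_divisors hn, ArithmeticFunction.cardFactors_eq_sum_factorization, Finsupp.sum,
    ← Finset.prod_pow_eq_pow_sum, Nat.support_factorization]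
  refine Finset.prod_le_prod (fun _ _ => Nat.zero_le _) fun p _ => ?_
  exact Nat.lt_two_pow_self

/-- `Ω(2^j m) = j + Ω(m)` for `m ≠ 0`. [folklore] -/
theorem cardFactors_two_pow_mul (j : ℕ) {m : ℕ} (hm : m ≠ 0) : cardFactors (2 ^ j * m) = j + cardFactors m := by
  rw [ArithmeticFunction.cardFactors_mul (pow_ne_zero _ two_ne_zero) hm,
    ArithmeticFunction.cardFactors_apply_prime_pow Nat.prime_two]

/-! ### Step 2: the odd numbers of `[1, M]` as the image of `c ↦ 2c - 1` -/

/-- `{n ∈ [1, M] : n odd} = {2c - 1 : c ∈ [1, (M+1)/2]}`. [folklore] -/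
theorem filter_odd_Icc_eq_image (M : ℕ) :
    (Icc 1 M).filter Odd = (Icc 1 ((M + 1) / 2)).image fun c => 2 * c - 1 := by
  ext n
  simp only [Finset.mem_filter, Finset.mem_Icc, Finset.mem_image]
  constructor
  · rintro ⟨⟨h1, hM⟩, ⟨c, rfl⟩⟩
    exact ⟨c + 1, ⟨by omega, by omega⟩, by omega⟩
  · rintro ⟨c, ⟨hc1, hcM⟩, rfl⟩
    exact ⟨⟨by omega, by omega⟩, ⟨c - 1, by omega⟩⟩

/-- `c ↦ 2c - 1` is injective on `ℕ`. [folklore] -/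
theorem two_mul_sub_one_injective : Function.Injective fun c : ℕ => 2 * c - 1 := by
  intro a b h
  simp only at h
  omega

/-- There are `(M+1)/2 ≥ M/2` odd numbers in `[1, M]`. [folklore] -/
theorem card_filter_odd_Icc (M : ℕ) : ((Icc 1 M).filter Odd).card = (M + 1) / 2 := by
  rw [filter_odd_Icc_eq_image, Finset.card_image_of_injective _ two_mul_sub_one_injective, Nat.card_Icc,
    Nat.add_sub_cancel]

/-- … hence at least `M/2` of them. [folklore] -/
theorem half_le_card_filter_odd_Icc (M : ℕ) : (M : ℝ) / 2 ≤ ((Icc 1 M).filter Odd).card := by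
  rw [card_filter_odd_Icc]
  have h : M ≤ (M + 1) / 2 * 2 := by omega
  have : (M : ℝ) ≤ ((M + 1) / 2 : ℕ) * 2 := by exact_mod_cast h
  linarith

/-- `Σ_{a ≤ M odd} 1/a ≥ ½ (log M - log 2)` (pair `2c-1` with `2c`). [folklore] -/
theorem sum_inv_odd_ge (M : ℕ) (hM : 1 ≤ M) :
    (Real.log M - Real.log 2) / 2 ≤ ∑ a ∈ (Icc 1 M).filter Odd, (1 : ℝ) / a := by
  rw [filter_odd_Icc_eq_image, Finset.sum_image fun a _ b _ h => two_mul_sub_one_injective h]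
  set L := (M + 1) / 2 with hL
  have hL1 : 1 ≤ L := by omega
  have hLM : (M : ℝ) / 2 ≤ L := by
    have h : M ≤ (M + 1) / 2 * 2 := by omega
    have : (M : ℝ) ≤ ((M + 1) / 2 : ℕ) * 2 := by exact_mod_cast h
    rw [hL]; linarith
  have h1 : ∑ c ∈ Icc 1 L, (1 : ℝ) / (2 * c) ≤ ∑ c ∈ Icc 1 L, (1 : ℝ) / ((2 * c - 1 : ℕ) : ℝ) := by
    refine Finset.sum_le_sum fun c hc => ?_
    rw [Finset.mem_Icc] at hc
    have hc' : ((2 * c - 1 : ℕ) : ℝ) = 2 * c - 1 := by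
      rw [Nat.cast_sub (by omega)]; push_cast; ring
    rw [hc']
    have : (1 : ℝ) ≤ c := by exact_mod_cast hc.1
    exact one_div_le_one_div_of_le (by linarith) (by linarith)
  have h2 : ∑ c ∈ Icc 1 L, (1 : ℝ) / (2 * c) = (1 / 2) * ∑ c ∈ Icc 1 L, (1 : ℝ) / c := by
    rw [Finset.mul_sum]
    refine Finset.sum_congr rfl fun c _ => ?_
    ring
  have h3 := log_le_sum_inv L
  have h4 : Real.log M - Real.log 2 ≤ Real.log L := by
    have hM0 : (0 : ℝ) < M := by exact_mod_cast hM
    rw [← Real.log_div hM0.ne' two_ne_zero]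
    exact Real.log_le_log (by positivity) hLM
  calc (Real.log M - Real.log 2) / 2 ≤ (1 / 2) * ∑ c ∈ Icc 1 L, (1 : ℝ) / c := by linarith
    _ = ∑ c ∈ Icc 1 L, (1 : ℝ) / (2 * c) := h2.symm
    _ ≤ _ := h1

/-! ### Step 3: the odd divisor sum `Σ_{n ≤ M odd} d(n) ≥ (M/4) log M - 2M` -/

/-- Double counting: `Σ_{n ≤ M odd} d(n) = Σ_{a ≤ M} #{n ≤ M odd : a ∣ n}`. [folklore] -/
theorem sum_odd_card_divisors (M : ℕ) :
    ∑ n ∈ (Icc 1 M).filter Odd, n.divisors.card =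
      ∑ a ∈ Icc 1 M, (((Icc 1 M).filter Odd).filter fun n => a ∣ n).card := by
  have hL : ∀ n ∈ (Icc 1 M).filter Odd, n.divisors.card = ∑ a ∈ Icc 1 M, if a ∣ n then 1 else 0 := by
    intro n hn
    simp only [Finset.mem_filter, Finset.mem_Icc] at hn
    rw [← Finset.card_filter]
    congr 1
    ext a
    simp only [Nat.mem_divisors, Finset.mem_filter, Finset.mem_Icc]
    constructor
    · rintro ⟨ha, -⟩
      exact ⟨⟨Nat.pos_of_dvd_of_pos ha (by omega), (Nat.le_of_dvd (by omega) ha).trans hn.1.2⟩, ha⟩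
    · rintro ⟨-, ha⟩
      exact ⟨ha, by omega⟩
  have hR : ∀ a ∈ Icc 1 M, (((Icc 1 M).filter Odd).filter fun n => a ∣ n).card =
      ∑ n ∈ (Icc 1 M).filter Odd, if a ∣ n then 1 else 0 := by
    intro a _
    rw [← Finset.card_filter]
  rw [Finset.sum_congr rfl hL, Finset.sum_congr rfl hR, Finset.sum_comm]

/-- For odd `a ∈ [1, M]`: `#{n ≤ M odd : a ∣ n} ≥ #{b ≤ M/a odd}` (`b ↦ ab`). [folklore] -/
theorem card_odd_multiples_ge {M a : ℕ} (ha : a ∈ (Icc 1 M).filter Odd) :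
    ((Icc 1 (M / a)).filter Odd).card ≤ (((Icc 1 M).filter Odd).filter fun n => a ∣ n).card := by
  simp only [Finset.mem_filter, Finset.mem_Icc] at ha
  obtain ⟨⟨ha1, haM⟩, haodd⟩ := ha
  refine Finset.card_le_card_of_injOn (fun b => a * b) (fun b hb => ?_) fun b₁ _ b₂ _ h => ?_
  · simp only [Finset.coe_filter, Finset.mem_Icc, Set.mem_setOf_eq, Finset.mem_filter] at hb ⊢
    obtain ⟨⟨hb1, hbM⟩, hbodd⟩ := hb
    refine ⟨⟨⟨Nat.mul_pos ha1 hb1, ?_⟩, haodd.mul hbodd⟩, dvd_mul_right a b⟩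
    calc a * b ≤ a * (M / a) := Nat.mul_le_mul_left a hbM
      _ ≤ M := Nat.mul_div_le M a
  · exact Nat.eq_of_mul_eq_mul_left ha1 h

/-- `Σ_{n ≤ M odd} d(n) ≥ (M/4) log M - 2M`. [folklore] -/
theorem sum_odd_card_divisors_ge (M : ℕ) :
    (M : ℝ) / 4 * Real.log M - 2 * M ≤ ∑ n ∈ (Icc 1 M).filter Odd, (n.divisors.card : ℝ) := by
  rcases Nat.eq_zero_or_pos M with rfl | hM
  · simp
  have hnat : ∑ a ∈ (Icc 1 M).filter Odd, ((Icc 1 (M / a)).filter Odd).card ≤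
      ∑ n ∈ (Icc 1 M).filter Odd, n.divisors.card := by
    rw [sum_odd_card_divisors]
    calc ∑ a ∈ (Icc 1 M).filter Odd, ((Icc 1 (M / a)).filter Odd).card
        ≤ ∑ a ∈ (Icc 1 M).filter Odd, (((Icc 1 M).filter Odd).filter fun n => a ∣ n).card :=
          Finset.sum_le_sum fun a ha => card_odd_multiples_ge ha
      _ ≤ ∑ a ∈ Icc 1 M, (((Icc 1 M).filter Odd).filter fun n => a ∣ n).card :=
          Finset.sum_le_sum_of_subset_of_nonneg (Finset.filter_subset _ _) fun _ _ _ => Nat.zero_le _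
  have h1 : (∑ a ∈ (Icc 1 M).filter Odd, (((Icc 1 (M / a)).filter Odd).card : ℝ)) ≤
      ∑ n ∈ (Icc 1 M).filter Odd, (n.divisors.card : ℝ) := by exact_mod_cast hnat
  have h2 : ∀ a ∈ (Icc 1 M).filter Odd, (M : ℝ) / (2 * a) - 1 ≤ (((Icc 1 (M / a)).filter Odd).card : ℝ) := by
    intro a ha
    simp only [Finset.mem_filter, Finset.mem_Icc] at ha
    have ha0 : (0 : ℝ) < a := by exact_mod_cast ha.1.1
    refine le_trans ?_ (half_le_card_filter_odd_Icc (M / a))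
    have h := Nat.lt_div_mul_add (a := M) (b := a) ha.1.1
    have h' : (M : ℝ) < (M / a : ℕ) * a + a := by exact_mod_cast h
    rw [div_sub_one (by positivity), div_le_div_iff₀ (by positivity) (by norm_num)]
    nlinarith
  have h3 : ∑ a ∈ (Icc 1 M).filter Odd, ((M : ℝ) / (2 * a) - 1) =
      (M : ℝ) / 2 * ∑ a ∈ (Icc 1 M).filter Odd, (1 : ℝ) / a - ((Icc 1 M).filter Odd).card := by
    rw [Finset.sum_sub_distrib, Finset.mul_sum, Finset.sum_const, nsmul_eq_mul, mul_one]
    congr 1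
    refine Finset.sum_congr rfl fun a _ => ?_
    ring
  have h4 : (((Icc 1 M).filter Odd).card : ℝ) ≤ M := by
    have : ((Icc 1 M).filter Odd).card ≤ (Icc 1 M).card := Finset.card_filter_le _ _
    simp only [Nat.card_Icc, add_tsub_cancel_right] at this
    exact_mod_cast this
  have h5 := sum_inv_odd_ge M hM
  have hM0 : (0 : ℝ) ≤ M := Nat.cast_nonneg M
  have hlog2 : Real.log 2 < 1 := by have := Real.log_two_lt_d9; linarith
  have h6 : (M : ℝ) / 4 * Real.log M - 2 * M ≤ (M : ℝ) / 2 * ∑ a ∈ (Icc 1 M).filter Odd, (1 : ℝ) / a - M := by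
    have := mul_le_mul_of_nonneg_left h5 (by positivity : (0 : ℝ) ≤ M / 2)
    have hlog2' : 0 < Real.log 2 := Real.log_pos one_lt_two
    nlinarith
  calc (M : ℝ) / 4 * Real.log M - 2 * M ≤ (M : ℝ) / 2 * ∑ a ∈ (Icc 1 M).filter Odd, (1 : ℝ) / a - M := h6
    _ ≤ (M : ℝ) / 2 * ∑ a ∈ (Icc 1 M).filter Odd, (1 : ℝ) / a - ((Icc 1 M).filter Odd).card := by linarith
    _ = ∑ a ∈ (Icc 1 M).filter Odd, ((M : ℝ) / (2 * a) - 1) := h3.symm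
    _ ≤ ∑ a ∈ (Icc 1 M).filter Odd, (((Icc 1 (M / a)).filter Odd).card : ℝ) := Finset.sum_le_sum h2
    _ ≤ _ := h1

/-! ### Step 4: dyadic decomposition `Σ_{n ≤ x} 2^{Ω(n)} ≥ Σ_{j ≤ J} 2^j Σ_{m ≤ x/2^j odd} 2^{Ω(m)}` -/

/-- `v_2(2^j m) = j` for odd `m`. [folklore] -/
theorem padicValNat_two_pow_mul_odd (j : ℕ) {m : ℕ} (hm : Odd m) : padicValNat 2 (2 ^ j * m) = j := by
  have hm0 : m ≠ 0 := fun h => by simp [h] at hm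
  rw [padicValNat.mul (pow_ne_zero _ two_ne_zero) hm0, padicValNat.prime_pow,
    padicValNat.eq_zero_of_not_dvd (fun h2 => (Nat.not_even_iff_odd.2 hm) (even_iff_two_dvd.2 h2)), add_zero]

/-- The dyadic pieces `{2^j m : m ≤ x/2^j odd}`, `j = 0..J`, are disjoint subsets of `[1, x]`, so for a non-negative
`g`: `Σ_{n ∈ [1,x]} g(n) ≥ Σ_{j ≤ J} Σ_{m ≤ x/2^j odd} g(2^j m)`. [folklore] -/
theorem sum_Icc_ge_sum_dyadic (g : ℕ → ℝ) (hg : ∀ n, 0 ≤ g n) (x J : ℕ) :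
    ∑ j ∈ Finset.range (J + 1), ∑ m ∈ (Icc 1 (x / 2 ^ j)).filter Odd, g (2 ^ j * m) ≤
      ∑ n ∈ Icc 1 x, g n := by
  classical
  set T : Finset (Σ _ : ℕ, ℕ) := (Finset.range (J + 1)).sigma fun j => (Icc 1 (x / 2 ^ j)).filter Odd with hT
  set φ : (Σ _ : ℕ, ℕ) → ℕ := fun t => 2 ^ t.1 * t.2 with hφ
  have hinj : Set.InjOn φ T := by
    rintro ⟨j, m⟩ hjm ⟨j', m'⟩ hjm' h
    simp only [hT, Finset.coe_sigma, Set.mem_sigma_iff, Finset.coe_range, Set.mem_Iio, Finset.coe_filter,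
      Finset.mem_Icc, Set.mem_setOf_eq] at hjm hjm'
    simp only [hφ] at h
    have hj : j = j' := by
      have := congrArg (padicValNat 2) h
      rwa [padicValNat_two_pow_mul_odd j hjm.2.2, padicValNat_two_pow_mul_odd j' hjm'.2.2] at this
    subst hj
    have hm : m = m' := Nat.eq_of_mul_eq_mul_left (pow_pos two_pos j) h
    subst hm
    rfl
  have hmaps : ∀ t ∈ T, φ t ∈ Icc 1 x := by
    rintro ⟨j, m⟩ hjm
    simp only [hT, Finset.mem_sigma, Finset.mem_range, Finset.mem_filter, Finset.mem_Icc] at hjm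
    obtain ⟨-, ⟨hm1, hmx⟩, -⟩ := hjm
    simp only [hφ, Finset.mem_Icc]
    refine ⟨Nat.mul_pos (pow_pos two_pos j) hm1, ?_⟩
    calc 2 ^ j * m ≤ 2 ^ j * (x / 2 ^ j) := Nat.mul_le_mul_left _ hmx
      _ ≤ x := Nat.mul_div_le x (2 ^ j)
  calc ∑ j ∈ Finset.range (J + 1), ∑ m ∈ (Icc 1 (x / 2 ^ j)).filter Odd, g (2 ^ j * m)
      = ∑ t ∈ T, g (φ t) := by rw [hT, Finset.sum_sigma]
    _ = ∑ n ∈ T.image φ, g n := (Finset.sum_image hinj).symm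
    _ ≤ ∑ n ∈ Icc 1 x, g n := by
        refine Finset.sum_le_sum_of_subset_of_nonneg (fun n hn => ?_) fun _ _ _ => hg _
        obtain ⟨t, ht, rfl⟩ := Finset.mem_image.1 hn
        exact hmaps t ht

/-! ### Step 5: `Σ_{n ≤ x} 2^{Ω(n)} ≥ (J+1) · x · ((log x)/16 - 2)` whenever `2^{J+1} ≤ √x` -/

/-- One dyadic piece: `2^j Σ_{m ≤ x/2^j odd} 2^{Ω(m)} ≥ x (log x)/16 - 2x` when `(j+1) log 2 ≤ (log x)/2`.
[folklore] -/
theorem dyadic_piece_ge {x j : ℕ} (hx : 3 ≤ x) (hj : ((j : ℝ) + 1) * Real.log 2 ≤ Real.log x / 2) :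
    (x : ℝ) * Real.log x / 16 - 2 * x ≤
      ∑ m ∈ (Icc 1 (x / 2 ^ j)).filter Odd, (2 : ℝ) ^ cardFactors (2 ^ j * m) := by
  set M := x / 2 ^ j with hM
  have hx0 : (0 : ℝ) < x := by exact_mod_cast (show 0 < x by omega)
  have hlogx : 1 < Real.log x := by
    rw [Real.lt_log_iff_exp_lt hx0]
    have := Real.exp_one_lt_d9
    have h3 : (3 : ℝ) ≤ x := by exact_mod_cast hx
    linarith
  -- `2^(j+1) ≤ x` (as reals and naturals)
  have hpow : (2 : ℝ) ^ (j + 1) ≤ x := by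
    have h1 : (2 : ℝ) ^ (j + 1) = Real.exp (((j : ℝ) + 1) * Real.log 2) := by
      rw [← Real.rpow_natCast, Real.rpow_def_of_pos two_pos]; push_cast; ring_nf
    rw [h1]
    calc Real.exp (((j : ℝ) + 1) * Real.log 2) ≤ Real.exp (Real.log x / 2) := Real.exp_le_exp.2 hj
      _ ≤ Real.exp (Real.log x) := Real.exp_le_exp.2 (by linarith)
      _ = x := Real.exp_log hx0
  have hpow_nat : 2 ^ (j + 1) ≤ x := by exact_mod_cast hpow
  -- `2^j M ≥ x/2`
  have h2jM : (x : ℝ) / 2 ≤ (2 : ℝ) ^ j * M := by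
    have h := Nat.lt_div_mul_add (a := x) (b := 2 ^ j) (pow_pos two_pos j)
    have h' : (x : ℝ) < (M : ℝ) * (2 : ℝ) ^ j + (2 : ℝ) ^ j := by rw [hM]; exact_mod_cast h
    have h'' : (2 : ℝ) * 2 ^ j ≤ x := by rw [pow_succ] at hpow; linarith
    nlinarith
  have h2jM' : (2 : ℝ) ^ j * M ≤ x := by
    have := Nat.div_mul_le_self x (2 ^ j)
    rw [hM, mul_comm]; exact_mod_cast this
  have hMpos : (0 : ℝ) < M := by
    have : (0 : ℝ) < (2 : ℝ) ^ j * M := by linarith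
    exact pos_of_mul_pos_right this (by positivity)
  -- `log M ≥ (log x)/2`
  have hlogM : Real.log x / 2 ≤ Real.log M := by
    have h1 : (x : ℝ) / 2 ^ (j + 1) ≤ M := by
      rw [div_le_iff₀ (by positivity), pow_succ]; linarith
    have h2 : Real.log ((x : ℝ) / 2 ^ (j + 1)) = Real.log x - ((j : ℝ) + 1) * Real.log 2 := by
      rw [Real.log_div hx0.ne' (by positivity), Real.log_pow]; push_cast; ring
    have h3 := Real.log_le_log (by positivity) h1
    rw [h2] at h3
    linarith
  -- termwise: `2^{Ω(2^j m)} = 2^j 2^{Ω(m)} ≥ 2^j d(m)`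
  have hterm : ∀ m ∈ (Icc 1 M).filter Odd, (2 : ℝ) ^ j * (m.divisors.card : ℝ) ≤ (2 : ℝ) ^ cardFactors (2 ^ j * m) := by
    intro m hm
    simp only [Finset.mem_filter, Finset.mem_Icc] at hm
    have hm0 : m ≠ 0 := by omega
    rw [cardFactors_two_pow_mul j hm0, pow_add]
    gcongr
    exact_mod_cast card_divisors_le_two_pow_cardFactors hm0
  have hsum : (2 : ℝ) ^ j * ((M : ℝ) / 4 * Real.log M - 2 * M) ≤
      ∑ m ∈ (Icc 1 M).filter Odd, (2 : ℝ) ^ cardFactors (2 ^ j * m) := by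
    calc (2 : ℝ) ^ j * ((M : ℝ) / 4 * Real.log M - 2 * M)
        ≤ (2 : ℝ) ^ j * ∑ m ∈ (Icc 1 M).filter Odd, (m.divisors.card : ℝ) :=
          mul_le_mul_of_nonneg_left (sum_odd_card_divisors_ge M) (by positivity)
      _ = ∑ m ∈ (Icc 1 M).filter Odd, (2 : ℝ) ^ j * (m.divisors.card : ℝ) := Finset.mul_sum _ _ _
      _ ≤ _ := Finset.sum_le_sum hterm
  -- arithmetic
  have hA : (x : ℝ) * Real.log x / 16 ≤ (2 : ℝ) ^ j * ((M : ℝ) / 4 * Real.log M) := by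
    have : (2 : ℝ) ^ j * ((M : ℝ) / 4 * Real.log M) = ((2 : ℝ) ^ j * M) / 4 * Real.log M := by ring
    rw [this]
    have hlx0 : 0 ≤ Real.log x / 2 := by linarith
    calc (x : ℝ) * Real.log x / 16 = (x / 2) / 4 * (Real.log x / 2) := by ring
      _ ≤ ((2 : ℝ) ^ j * M) / 4 * Real.log M := by gcongr
  have hB : -(2 * (x : ℝ)) ≤ -((2 : ℝ) ^ j * (2 * M)) := by linarith
  calc (x : ℝ) * Real.log x / 16 - 2 * x ≤ (2 : ℝ) ^ j * ((M : ℝ) / 4 * Real.log M - 2 * M) := by linarith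
    _ ≤ _ := hsum

/-- `Σ_{n ≤ x} 2^{Ω(n)} ≥ (J+1) (x (log x)/16 - 2x)` whenever `(J+1) log 2 ≤ (log x)/2`, `x ≥ 3`. [folklore] -/
theorem sum_two_pow_cardFactors_ge {x J : ℕ} (hx : 3 ≤ x) (hJ : ((J : ℝ) + 1) * Real.log 2 ≤ Real.log x / 2) :
    ((J : ℝ) + 1) * ((x : ℝ) * Real.log x / 16 - 2 * x) ≤ ∑ n ∈ Icc 1 x, (2 : ℝ) ^ cardFactors n := by
  refine le_trans ?_ (sum_Icc_ge_sum_dyadic (fun n => (2 : ℝ) ^ cardFactors n) (fun _ => by positivity) x J)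
  have h : ∀ j ∈ Finset.range (J + 1), (x : ℝ) * Real.log x / 16 - 2 * x ≤
      ∑ m ∈ (Icc 1 (x / 2 ^ j)).filter Odd, (2 : ℝ) ^ cardFactors (2 ^ j * m) := by
    intro j hj
    rw [Finset.mem_range] at hj
    refine dyadic_piece_ge hx (le_trans ?_ hJ)
    have : (j : ℝ) + 1 ≤ (J : ℝ) + 1 := by exact_mod_cast (show j + 1 ≤ J + 1 by omega)
    exact mul_le_mul_of_nonneg_right this (Real.log_pos one_lt_two).le
  calc ((J : ℝ) + 1) * ((x : ℝ) * Real.log x / 16 - 2 * x)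
      = ∑ _j ∈ Finset.range (J + 1), ((x : ℝ) * Real.log x / 16 - 2 * x) := by
        rw [Finset.sum_const, Finset.card_range, nsmul_eq_mul]; push_cast; ring
    _ ≤ _ := Finset.sum_le_sum h

/-! ### Step 6: the normalised sum of `![X]` at `y = 2` tends to `+∞` -/

/-- `Ω_{![X]}(n) = Ω(n)`. [folklore] -/
theorem cardFactorsStat_X (n : ℕ) :
    (∑ i, cardFactors ((((![X] : Fin 1 → ℤ[X]) i).eval (n : ℤ)).toNat)) = cardFactors n := by
  simp

/-- AT `y = 2` THE Ω-NORMALISED SUM OF `f = X` DIVERGES: `x⁻¹ (log x)^{-1} Σ_{n ≤ x} 2^{Ω(n)} → +∞` (indeed it is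
`≍ log x`: Grosswald; here `≥ (J+1)/32` as soon as `2^{J+1} ≤ √x` and `log x ≥ 64`). [folklore] -/
theorem tendsto_omegaNormSum_X_two_atTop :
    Tendsto (fun x : ℕ => (x : ℝ)⁻¹ * Real.exp ((1 : ℕ) * (1 - (2 : ℝ)) * Real.log (Real.log x)) *
      ∑ n ∈ Finset.range (x + 1), (2 : ℝ) ^ (∑ i, cardFactors ((((![X] : Fin 1 → ℤ[X]) i).eval (n : ℤ)).toNat)))
      atTop atTop := by
  simp only [cardFactorsStat_X]
  refine Filter.tendsto_atTop.2 fun B => ?_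
  set J : ℕ := ⌈32 * max B 0⌉₊ with hJ
  have hlog := Real.tendsto_log_atTop.comp tendsto_natCast_atTop_atTop
  filter_upwards [eventually_ge_atTop 3, hlog.eventually_ge_atTop (max 64 (2 * (((J : ℝ) + 1) * Real.log 2)))]
    with x hx hlx
  simp only [Function.comp_apply, max_le_iff] at hlx
  obtain ⟨hl64, hlJ⟩ := hlx
  have hx0 : (0 : ℝ) < x := by exact_mod_cast (show 0 < x by omega)
  have hlpos : 0 < Real.log x := by linarith
  have hexp : Real.exp ((1 : ℕ) * (1 - (2 : ℝ)) * Real.log (Real.log x)) = (Real.log x)⁻¹ := by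
    rw [show ((1 : ℕ) : ℝ) * (1 - 2) * Real.log (Real.log x) = -Real.log (Real.log x) by push_cast; ring,
      Real.exp_neg, Real.exp_log hlpos]
  rw [hexp]
  have hrange : ∑ n ∈ Icc 1 x, (2 : ℝ) ^ cardFactors n ≤ ∑ n ∈ Finset.range (x + 1), (2 : ℝ) ^ cardFactors n :=
    Finset.sum_le_sum_of_subset_of_nonneg (fun n hn => by
      simp only [Finset.mem_Icc, Finset.mem_range] at hn ⊢; omega) fun _ _ _ => by positivity
  have hS := (sum_two_pow_cardFactors_ge (J := J) hx (by linarith)).trans hrange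
  have hJB : B ≤ ((J : ℝ) + 1) / 32 := by
    have h1 : 32 * max B 0 ≤ J := Nat.le_ceil _
    have h2 : B ≤ max B 0 := le_max_left _ _
    linarith
  have hxl : 0 < (x : ℝ) * Real.log x := by positivity
  have hkey : ((J : ℝ) + 1) / 32 * ((x : ℝ) * Real.log x) ≤ ∑ n ∈ Finset.range (x + 1), (2 : ℝ) ^ cardFactors n := by
    refine le_trans ?_ hS
    have hJ0 : (0 : ℝ) ≤ (J : ℝ) + 1 := by positivity
    have h64 : (x : ℝ) * 64 ≤ (x : ℝ) * Real.log x := mul_le_mul_of_nonneg_left hl64 hx0.le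
    have h32 : (x : ℝ) * Real.log x / 32 ≤ (x : ℝ) * Real.log x / 16 - 2 * x := by linarith
    calc ((J : ℝ) + 1) / 32 * ((x : ℝ) * Real.log x) = ((J : ℝ) + 1) * ((x : ℝ) * Real.log x / 32) := by ring
      _ ≤ ((J : ℝ) + 1) * ((x : ℝ) * Real.log x / 16 - 2 * x) := mul_le_mul_of_nonneg_left h32 hJ0
  have heq : (x : ℝ)⁻¹ * (Real.log x)⁻¹ * ∑ n ∈ Finset.range (x + 1), (2 : ℝ) ^ cardFactors n =
      (∑ n ∈ Finset.range (x + 1), (2 : ℝ) ^ cardFactors n) / ((x : ℝ) * Real.log x) := by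
    rw [← mul_inv, inv_mul_eq_div]
  rw [heq]
  exact hJB.trans ((le_div_iff₀ hxl).2 hkey)

/-- Hence the Ω-law of the crux has NO limit at `y = 2` for `f = X`, whatever value is proposed. [folklore] -/
theorem not_tendsto_omegaNormSum_X_two (L : ℂ) :
    ¬Tendsto (fun x : ℕ => (x : ℂ)⁻¹ * Complex.exp (((1 : ℕ) : ℂ) * (1 - ((2 : ℝ) : ℂ)) *
        (Real.log (Real.log x) : ℂ)) * ∑ n ∈ Finset.range (x + 1), ((2 : ℝ) : ℂ) ^ (∑ i, cardFactors ((((![X] :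
          Fin 1 → ℤ[X]) i).eval (n : ℤ)).toNat))) atTop (𝓝 L) := by
  have hofReal : ∀ x : ℕ, (x : ℂ)⁻¹ * Complex.exp (((1 : ℕ) : ℂ) * (1 - ((2 : ℝ) : ℂ)) *
      (Real.log (Real.log x) : ℂ)) * ∑ n ∈ Finset.range (x + 1), ((2 : ℝ) : ℂ) ^ (∑ i, cardFactors ((((![X] :
        Fin 1 → ℤ[X]) i).eval (n : ℤ)).toNat)) =
      (((x : ℝ)⁻¹ * Real.exp ((1 : ℕ) * (1 - (2 : ℝ)) * Real.log (Real.log x)) *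
        ∑ n ∈ Finset.range (x + 1), (2 : ℝ) ^ (∑ i, cardFactors ((((![X] : Fin 1
            → ℤ[X]) i).eval (n : ℤ)).toNat)) : ℝ) : ℂ) := fun x => by
    push_cast
    rfl
  intro h
  exact not_tendsto_ofReal_of_tendsto_atTop tendsto_omegaNormSum_X_two_atTop L (h.congr hofReal)

/-- THE CLOSED SEGMENT FAILS AT ITS ENDPOINT: the crux with `y < 7/4` replaced by `y ≤ 2` (ball `|z| < 2` and
`Λ 0 = C(f)` unchanged) is FALSE — witness the Bateman–Horn system `![X]` at `y = 2` exactly, where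
`x⁻¹ (log x)^{-1} Σ_{n≤x} 2^{Ω(n)} ≍ log x → ∞` (the pole of the `p = 2` Euler factor `(1 - z/2)^{-1}` of
`Λ_X(z) = ∏_p (1 - z/p)^{-1}(1 - 1/p)^z`). Together with `not_lsdRealSegment_wide` (every `b > 2`): the real-segment
law for the un-capped `Ω` lives exactly on `y < 2`. [folklore] -/
theorem not_lsdRealSegment_upto_two :
    ¬ ∀ (k : ℕ) (f : Fin k → ℤ[X]), IsBatemanHornSystem f → ∃ Λ : ℂ → ℂ, DifferentiableOn ℂ Λ (Metric.ball 0 2) ∧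
      Λ 0 = (batemanHornConst f : ℂ) ∧ ∀ y : ℝ, 5 / 4 < y → y ≤ 2 →
        Filter.Tendsto (fun x : ℕ => (x : ℂ)⁻¹
            * Complex.exp ((k : ℂ) * (1 - (y : ℂ)) * (Real.log (Real.log x) : ℂ)) *
          ∑ n ∈ Finset.range (x + 1), (y : ℂ) ^ (∑ i, cardFactors (((f i).eval (n : ℤ)).toNat))) Filter.atTop
          (nhds (Λ y * Complex.exp (((y : ℂ) - 1) * (Real.log (∏ i, ((f i).natDegree : ℝ)) : ℂ)) *
            (Complex.Gamma y)⁻¹ ^ k)) := by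
  intro h
  obtain ⟨Λ, _, _, hlaw⟩ := h 1 ![X] isBatemanHornSystem_X
  exact not_tendsto_omegaNormSum_X_two _ (hlaw 2 (by norm_num) le_rfl)

/-! ## §6 Calibration and why `LSDRealSegment` resists

* `H_x(1) = (x+1)/x → 1` for EVERY family (`normSum_one_tendsto`): consistent with `λ_f(1) = 1`, `Γ(1) = 1`,
  `D^0 = 1` — the point `y = 1` (outside the segment) carries no information, and the crux rightly avoids it.
* Known instances: `k = 0` (§2, proved); `k = 1`, `f = ![X]`: Selberg 1954 / Montgomery–Vaughan Thm 7.18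
  (vendored fact `MontgomeryVaughan2007_thm_7_18_Omega`, `Λ = ∏_p (1 - z/p)^{-1}(1 - 1/p)^z`, `Λ(0) = 1 = C(X)`);
  linear `aX + b` in general: Selberg–Delange in progressions (`Λ(0) = a/φ(a) = C(aX+b)`, consistent).
* WHY NO KILL (cycle 1). (i) Every junk/degenerate instance admitted by `IsBatemanHornSystem` is consistent: the
  empty family holds; constants are excluded by `hasNoFixedPrimeDivisor` + positivity; duplicates by
  `pairwise_not_associated`; negative values by `leadingCoeff_pos` — and dropping any of these three IS fatal (§3),
  so the hypothesis set is exactly right, while a fixed prime divisor is harmless (both sides vanish at `0`).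
  (ii) The typed limit is the prediction of the standard model "`f_i(n)`, `n ≤ x`, factor like independent random
  integers of size `x^{deg f_i}` with local densities `ω`": exponent `k(y-1)` from `Σ_p ω_f(p)/p ~ k log log x`
  (prime ideal theorem), `D^{y-1}` from `log(x^{d_i}) = d_i log x`, `Γ(y)^{-k}` the Poisson–Dirichlet correction per
  factor, `λ_f(0) = C(f)` since `E_p(0) = 1 - ω_f(p)/p`; the same model gives the Dickman law `ρ(d u)` for smooth
  values of `f`, which is a THEOREM under uniform Bateman–Horn (G. Martin, J. Number Theory 2002), the planner's
  numerics (X²+1, twins) agree to 1–3 %, and this seat's cubic check (f = X³+2, D = 3, exact Ω up to 4·10⁵) agrees to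
  0.5 % at every y ∈ {1.25, 1.4, 1.5, 1.6, 1.75} — a wrong `D^{y-1}` (3^{0.75} = 2.28) or Γ-power would show at once. A substantive counterexample would be an anomaly in the anatomy of polynomial values contradicting that
  model — none is known in print. (iii) The radius: `E_2` and all `E_p` have radius `≥ 2` for every BH system
  (root counts mod `p^v` of the squarefree `∏ f_i` are bounded), so "Λ holomorphic on the OPEN ball of radius 2" is
  not refutable by a pole, and the segment `(5/4, 7/4)` stays clear of the genuine wall at `2` (§5).
  (iv) What the crux really asks (for provers): an ASYMPTOTIC, with constant, for `Σ_{n≤x} y^{Ω(f(n))}`, `deg f ≥ 2`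
  — divisor-type sums of `f(n)` with level of distribution BEYOND `x` (large prime factors of `f(n)` weighted
  `y` vs `y²`); Nair–Tenenbaum give only the order of magnitude. Open, parity-free, correctly labelled. -/

/-- Calibration at `y = 1`: `H_x(1) = (x+1)/x → 1` for every family. [folklore] -/
theorem normSum_one_tendsto (k : ℕ) (f : Fin k → ℤ[X]) :
    Tendsto (fun x : ℕ => (x : ℂ)⁻¹ * Complex.exp ((k : ℂ) * (1 - ((1 : ℝ) : ℂ)) * (Real.log (Real.log x) : ℂ)) *
      ∑ n ∈ Finset.range (x + 1), ((1 : ℝ) : ℂ) ^ (∑ i, cardFactors (((f i).eval (n : ℤ)).toNat))) atTop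
      (𝓝 1) := by
  have := (Complex.continuous_ofReal.tendsto (1 : ℝ)).comp tendsto_inv_mul_succ'
  rw [Complex.ofReal_one] at this
  refine this.congr fun x => ?_
  simp only [Function.comp_apply, Complex.ofReal_one, one_pow, Finset.sum_const, Finset.card_range,
    nsmul_eq_mul, mul_one, sub_self, mul_zero, zero_mul, Complex.exp_zero]
  push_cast
  ring

/-! ## §7 The linear rung `f = X` (cycle 2): holomorphy of Selberg's `F(1,·)` on `|z| < 2` -/

/-- Each Euler factor `z ↦ E_p(1, z) = (1 - z/p)⁻¹ (1 - 1/p)^z` is holomorphic on `|z| < 2` (`p ≥ 2 > |z|`).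
[cite: MontgomeryVaughan2007, §7.4 (7.60)] -/
theorem differentiableOn_eulerFactor_one (p : Nat.Primes) :
    DifferentiableOn ℂ (fun z : ℂ => eulerFactor p 1 z) (Metric.ball 0 2) := by
  intro z hz
  have hz2 : ‖z‖ < 2 := by simpa [Metric.mem_ball, dist_zero_right] using hz
  have hne : (1 : ℂ) - z * ((p : ℕ) : ℂ) ^ (-(1 : ℂ)) ≠ 0 :=
    one_sub_ne_zero (R := ‖z‖) hz2 le_rfl (by simp only [sigma0, Complex.one_re]; linarith [norm_nonneg z])
  refine DifferentiableAt.differentiableWithinAt ?_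
  unfold eulerFactor
  fun_prop (disch := exact hne)

/-- `F(1, ·) = ∏_p E_p(1, ·)` converges locally uniformly on `|z| < 2`. [cite: MontgomeryVaughan2007, §7.4 (7.60)] -/
theorem hasProdLocallyUniformlyOn_eulerFactor_one :
    HasProdLocallyUniformlyOn (fun (p : Nat.Primes) (z : ℂ) => eulerFactor p 1 z) (fun z => bigOmegaF 1 z)
      (Metric.ball 0 2) := by
  apply hasProdLocallyUniformlyOn_of_forall_compact Metric.isOpen_ball
  intro K hK hcK
  obtain ⟨R, hR2, hKR⟩ := exists_lt_subset_ball hcK.isClosed hK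
  have hu : Summable fun p : Nat.Primes ↦ 5 * (R + R ^ 2) * ((p : ℕ) : ℝ) ^ (-(2 * (1 : ℝ))) :=
    ((Nat.Primes.summable_rpow (r := -(2 * (1 : ℝ)))).2 (by norm_num)).mul_left _
  have hev : ∀ᶠ p : Nat.Primes in cofinite, ∀ z ∈ K,
      ‖(eulerFactor p 1 z - 1)‖ ≤ 5 * (R + R ^ 2) * ((p : ℕ) : ℝ) ^ (-(2 * (1 : ℝ))) := by
    filter_upwards [eventually_norm_eulerFactor_sub_one_le (σ₁ := 1) one_pos R] with p hp z hz
    have hzR : ‖z‖ ≤ R := by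
      have := hKR hz
      rw [Metric.mem_ball, dist_zero_right] at this
      exact this.le
    exact hp 1 z (by simp) hzR
  have hcts : ∀ p : Nat.Primes, ContinuousOn (fun z => eulerFactor p 1 z - 1) K := fun p =>
    (((differentiableOn_eulerFactor_one p).continuousOn.mono hK).sub continuousOn_const)
  have h := hu.hasProdUniformlyOn_one_add hcK hev hcts
  simp only [add_sub_cancel] at h
  simpa only [bigOmegaF] using h

/-- **`F(1,·) = selbergDelangeOmegaF` is holomorphic on `|z| < 2`** (the `Λ` of the crux at `f = X`).
[cite: MontgomeryVaughan2007, §7.4 (7.60)] -/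
theorem differentiableOn_selbergDelangeOmegaF : DifferentiableOn ℂ selbergDelangeOmegaF (Metric.ball 0 2) := by
  have hd : DifferentiableOn ℂ (fun z => bigOmegaF 1 z) (Metric.ball 0 2) :=
    hasProdLocallyUniformlyOn_eulerFactor_one.differentiableOn
      (.of_forall fun s => by
        simpa [Finset.prod_fn] using
          DifferentiableOn.finsetProd (u := s) (fun p _ => differentiableOn_eulerFactor_one p))
      Metric.isOpen_ball
  exact hd.congr fun z _ => (bigOmegaF_one z).symm

/-- `F(1, 0) = 1` (`= C(X)`). [cite: MontgomeryVaughan2007, §7.4 (7.60)] -/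
theorem selbergDelangeOmegaF_zero : selbergDelangeOmegaF 0 = 1 := by
  simp [selbergDelangeOmegaF_apply]


/-! ### §7b Selberg's theorem gives the segment law at `f = X` with `Λ = F(1,·)` -/

/-- The sum of the crux for `f = X` is `1 + A_z(x)`, `A_z(x) = Σ_{1 ≤ n ≤ x} z^{Ω(n)}`. [folklore] -/
theorem sum_X_eq (x : ℕ) (z : ℂ) :
    ∑ n ∈ Finset.range (x + 1), z ^ (∑ i, cardFactors ((((![X] : Fin 1 → ℤ[X]) i).eval (n : ℤ)).toNat)) =
      1 + ∑ n ∈ Finset.Icc 1 x, z ^ cardFactors n := by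
  have h : ∀ n : ℕ, (∑ i, cardFactors ((((![X] : Fin 1 → ℤ[X]) i).eval (n : ℤ)).toNat)) = cardFactors n :=
    fun n => by simp
  simp_rw [h]
  rw [Nat.range_succ_eq_Icc_zero, Finset.Icc_eq_cons_Ioc (Nat.zero_le x), Finset.sum_cons,
    ← Finset.Icc_add_one_left_eq_Ioc, zero_add]
  simp

/-- The archimedean factor at `f = X` is `Γ(y)⁻¹` (`D = natDegree X = 1`, `log 1 = 0`). [folklore] -/
theorem archFactor_X (y : ℝ) :
    Complex.exp (((y : ℂ) - 1) * (Real.log (∏ i, (((![X] : Fin 1 → ℤ[X]) i).natDegree : ℝ)) : ℂ)) *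
      (Complex.Gamma y)⁻¹ ^ 1 = (Complex.Gamma y)⁻¹ := by
  simp

/-- The normaliser cancels the main-term power: `e^{(1-y) log L} · L^{y-1} = 1` for `L > 0`. [folklore] -/
theorem exp_mul_cpow_eq_one {L : ℝ} (hL : 0 < L) (w : ℂ) :
    Complex.exp (((1 : ℕ) : ℂ) * (1 - w) * (Real.log L : ℂ)) * ((L : ℂ) ^ (w - 1)) = 1 := by
  rw [Complex.cpow_def_of_ne_zero (by exact_mod_cast hL.ne'), ← Complex.ofReal_log hL.le, ← Complex.exp_add]
  convert Complex.exp_zero using 2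
  push_cast
  ring

/-- Norm of the normaliser: `‖e^{(1-y) log L}‖ = L^{1-y} ≤ 1` for `L ≥ 1`, `y ≥ 1`. [folklore] -/
theorem norm_exp_normaliser_le_one {L y : ℝ} (hL : 1 ≤ L) (hy : 1 ≤ y) :
    ‖Complex.exp (((1 : ℕ) : ℂ) * (1 - (y : ℂ)) * (Real.log L : ℂ))‖ ≤ 1 := by
  rw [Complex.norm_exp]
  have hre : (((1 : ℕ) : ℂ) * (1 - (y : ℂ)) * (Real.log L : ℂ)).re = (1 - y) * Real.log L := by
    simp [Complex.mul_re]
  rw [hre, Real.exp_le_one_iff]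
  exact mul_nonpos_of_nonpos_of_nonneg (by linarith) (Real.log_nonneg hL)

/-- **SEGMENT LAW AT `f = X`** (indeed for every real `1 ≤ y < 2`): Selberg's theorem
(`MontgomeryVaughan2007_thm_7_18_Omega`, PROVED in the tree) gives
`x⁻¹ (log x)^{1-y} Σ_{n ≤ x} y^{Ω(n)} → F(1,y)/Γ(y)`. [cite: MontgomeryVaughan2007, §7.4 Theorem 7.18 and (7.60)] -/
theorem tendsto_normSum_X {y : ℝ} (hy1 : 1 ≤ y) (hy2 : y < 2) :
    Tendsto (fun x : ℕ => (x : ℂ)⁻¹ * Complex.exp (((1 : ℕ) : ℂ) * (1 - (y : ℂ)) * (Real.log (Real.log x) : ℂ)) *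
      ∑ n ∈ Finset.range (x + 1), (y : ℂ) ^ (∑ i, cardFactors ((((![X] : Fin 1 → ℤ[X]) i).eval (n : ℤ)).toNat)))
      atTop (𝓝 (selbergDelangeOmegaF y * (Complex.Gamma y)⁻¹)) := by
  obtain ⟨C, hC⟩ := MontgomeryVaughan2007_thm_7_18_Omega_holds y hy2
  set w : ℂ := (y : ℂ) with hw
  set G : ℂ := selbergDelangeOmegaF w * (Complex.Gamma w)⁻¹ with hG
  have hwn : ‖w‖ ≤ y := by rw [hw, Complex.norm_real, Real.norm_eq_abs, abs_of_nonneg (by linarith)]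
  -- the bound `‖Q x - G‖ ≤ x⁻¹ + max C 0 · (log x)⁻¹` for `x ≥ 3`
  have hbound : ∀ x : ℕ, 3 ≤ x →
      ‖(x : ℂ)⁻¹ * Complex.exp (((1 : ℕ) : ℂ) * (1 - w) * (Real.log (Real.log x) : ℂ)) *
          ∑ n ∈ Finset.range (x + 1), w ^ (∑ i, cardFactors ((((![X] : Fin 1 → ℤ[X]) i).eval (n : ℤ)).toNat))
        - G‖ ≤ (x : ℝ)⁻¹ + max C 0 * (Real.log x) ^ (-(2 - y)) := by
    intro x hx
    have hx0 : (0 : ℝ) < x := by exact_mod_cast (show 0 < x by omega)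
    have hx2 : (2 : ℝ) ≤ x := by exact_mod_cast (show 2 ≤ x by omega)
    have hL : 1 < Real.log x := by
      rw [Real.lt_log_iff_exp_lt hx0]
      have := Real.exp_one_lt_d9
      have h3 : (3 : ℝ) ≤ x := by exact_mod_cast hx
      linarith
    have hL0 : 0 < Real.log x := by linarith
    set L : ℝ := Real.log x with hLdef
    set S : ℂ := ∑ n ∈ Finset.Icc 1 x, w ^ cardFactors n with hS
    set M : ℂ := selbergDelangeOmegaF w * (Complex.Gamma w)⁻¹ * (x : ℂ) * ((L : ℝ) : ℂ) ^ (w - 1) with hM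
    have hMV : ‖S - M‖ ≤ C * x * L ^ (y - 2) := by
      have := hC x hx2 w hwn
      rwa [Nat.floor_natCast] at this
    have hMV' : ‖S - M‖ ≤ max C 0 * x * L ^ (y - 2) := by
      refine hMV.trans ?_
      gcongr
      exact le_max_left _ _
    set e : ℂ := Complex.exp (((1 : ℕ) : ℂ) * (1 - w) * (Real.log L : ℂ)) with he
    have he1 : e * ((L : ℂ) ^ (w - 1)) = 1 := exp_mul_cpow_eq_one hL0 w
    have hxne : (x : ℂ) ≠ 0 := by exact_mod_cast (show (x : ℕ) ≠ 0 by omega)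
    have hxinv : (x : ℂ)⁻¹ * (x : ℂ) = 1 := inv_mul_cancel₀ hxne
    have hkey : (x : ℂ)⁻¹ * e * (1 + S) - G = (x : ℂ)⁻¹ * e * (1 + (S - M)) := by
      rw [hM, ← hG]
      linear_combination G * hxinv + G * ((x : ℂ)⁻¹ * (x : ℂ)) * he1
    rw [sum_X_eq, hkey]
    have hne : ‖e‖ ≤ 1 := norm_exp_normaliser_le_one hL.le hy1
    have hxinvR : ‖(x : ℂ)⁻¹‖ = (x : ℝ)⁻¹ := by simp
    calc ‖(x : ℂ)⁻¹ * e * (1 + (S - M))‖ = (x : ℝ)⁻¹ * ‖e‖ * ‖1 + (S - M)‖ := by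
          rw [norm_mul, norm_mul, hxinvR]
      _ ≤ (x : ℝ)⁻¹ * 1 * (1 + max C 0 * x * L ^ (y - 2)) := by
          gcongr
          exact (norm_add_le _ _).trans (by simpa using hMV')
      _ = (x : ℝ)⁻¹ + max C 0 * L ^ (y - 2) := by field_simp
      _ = (x : ℝ)⁻¹ + max C 0 * L ^ (-(2 - y)) := by rw [show y - 2 = -(2 - y) by ring]
  -- the right-hand side tends to `0`
  have hrhs : Tendsto (fun x : ℕ => (x : ℝ)⁻¹ + max C 0 * (Real.log x) ^ (-(2 - y))) atTop (𝓝 0) := by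
    have h1 : Tendsto (fun x : ℕ => (x : ℝ)⁻¹) atTop (𝓝 0) := tendsto_inv_atTop_nhds_zero_nat
    have h2 : Tendsto (fun x : ℕ => (Real.log x) ^ (-(2 - y))) atTop (𝓝 0) :=
      (tendsto_rpow_neg_atTop (by linarith : 0 < 2 - y)).comp
        (Real.tendsto_log_atTop.comp tendsto_natCast_atTop_atTop)
    simpa using h1.add (h2.const_mul (max C 0))
  rw [tendsto_iff_norm_sub_tendsto_zero]
  refine squeeze_zero_norm' ?_ hrhs
  filter_upwards [eventually_ge_atTop 3] with x hx
  rw [norm_norm]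
  exact hbound x hx

/-- `SegmentLaw 1 (X) F(1,·)`: the crux's real-segment law HOLDS for the integers. [cite: MontgomeryVaughan2007, §7.4 Theorem 7.18 and (7.60)] -/
theorem segmentLaw_X : SegmentLaw 1 ![X] selbergDelangeOmegaF := by
  intro y hy hy'
  rw [archFactor_X]
  simpa using tendsto_normSum_X (y := y) (by linarith) (by linarith)

/-- `C(X) = 1`. [folklore] -/
theorem batemanHornConst_X : batemanHornConst (![X] : Fin 1 → ℤ[X]) = 1 := by
  have hpart : batemanHornPartial (![X] : Fin 1 → ℤ[X]) = fun _ => 1 := by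
    funext x
    unfold batemanHornPartial
    refine Finset.prod_eq_one fun p hp => ?_
    have hp' := Nat.prime_of_mem_primesLE hp
    have hp0 : (0 : ℝ) < p := by exact_mod_cast hp'.pos
    have hlt : 1 / (p : ℝ) < 1 := by rw [div_lt_one hp0]; exact_mod_cast hp'.one_lt
    rw [polyRootCountMod_X hp', Fintype.card_fin, pow_one, Nat.cast_one]
    exact inv_mul_cancel₀ (ne_of_gt (by linarith))
  rw [batemanHornConst, hpart]
  exact tendsto_const_nhds.limUnder_eq

/-- **THE CRUX HOLDS AT `f = X`** with `Λ = F(1,·) = ∏_p (1 - z/p)⁻¹(1 - 1/p)^z`: holomorphic on `|z| < 2`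
(§7), `Λ 0 = 1 = C(X)`, and the segment law is Selberg's theorem. Full calibration of the typed normalisation
(`x⁻¹`, `(log x)^{k(1-y)}`, `D^{y-1}`, `Γ(y)^{-k}`, the pin `Λ 0 = C(f)`) against a theorem PROVED in the tree: no
misstatement kill exists at the linear rung. [cite: MontgomeryVaughan2007, §7.4 Theorem 7.18 and (7.60)] -/
theorem conclusion_X : Conclusion 1 ![X] := by
  refine ⟨selbergDelangeOmegaF, differentiableOn_selbergDelangeOmegaF, ?_, fun y hy hy' => ?_⟩
  · rw [selbergDelangeOmegaF_zero, batemanHornConst_X]; simp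
  · have := segmentLaw_X y hy hy'
    simpa [mul_assoc] using this


/-! ### §7c Rigidity at `f = X`: the witness `Λ` is forced to be `F(1,·)` (so `Λ 0 = 1 = C(X)` is forced AND true) -/

/-- RIGIDITY AT `f = X`: every `Λ` holomorphic on `|z| < 2` satisfying the crux's segment law for `(X)` coincides with
Selberg's `F(1,·)` on the ball (limits are unique, the Γ-factor is non-zero, identity theorem). [folklore] -/
theorem eqOn_selbergDelangeOmegaF_of_segmentLaw_X {Λ : ℂ → ℂ} (hΛ : DifferentiableOn ℂ Λ (Metric.ball 0 2))
    (hlaw : SegmentLaw 1 ![X] Λ) : Set.EqOn Λ selbergDelangeOmegaF (Metric.ball 0 2) := by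
  refine eqOn_ball_of_eqOn_segment hΛ differentiableOn_selbergDelangeOmegaF fun y hy hy' => ?_
  have := tendsto_nhds_unique (hlaw y hy hy') (segmentLaw_X y hy hy')
  exact mul_right_cancel₀ (gammaFactor_ne_zero 1 _ (by linarith)) this

/-- … in particular its pinned value is `Λ 0 = F(1,0) = 1 = C(X)`: at the linear rung the clause `Λ 0 = C(f)` is
both FORCED and CORRECT. [folklore] -/
theorem apply_zero_eq_one_of_segmentLaw_X {Λ : ℂ → ℂ} (hΛ : DifferentiableOn ℂ Λ (Metric.ball 0 2))
    (hlaw : SegmentLaw 1 ![X] Λ) : Λ 0 = 1 := by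
  rw [eqOn_selbergDelangeOmegaF_of_segmentLaw_X hΛ hlaw (Metric.mem_ball_self two_pos), selbergDelangeOmegaF_zero]

/-! ### §7d The pole at `2`: `Re F(1,y) ≥ ¼ (1 - y/2)⁻¹` for real `1 ≤ y < 2`, and the SHARP holomorphy radius -/

/-- The Euler factor at a real point is a real number: `E_p(1,y) = (1 - y/p)⁻¹ (1 - 1/p)^y`. [folklore] -/
theorem eulerFactor_one_ofReal (p : Nat.Primes) (y : ℝ) :
    eulerFactor p 1 (y : ℂ) = (((1 - y / p)⁻¹ * (1 - 1 / (p : ℝ)) ^ y : ℝ) : ℂ) := by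
  rw [eulerFactor_one]
  have hp : (0 : ℝ) ≤ 1 - 1 / (p : ℝ) := by
    have : (1 : ℝ) ≤ p := by exact_mod_cast p.prop.one_lt.le
    rw [sub_nonneg, div_le_one (by positivity)]
    exact this
  push_cast
  rw [Complex.ofReal_cpow hp]
  push_cast
  rfl

/-- Bernoulli: for real `1 ≤ y < p` the real Euler factor is `≥ 1` (`(1 - 1/p)^y ≥ 1 - y/p`). [folklore] -/
theorem one_le_realEulerFactor {p : ℕ} (hp : 2 ≤ p) {y : ℝ} (hy1 : 1 ≤ y) (hyp : y < p) :
    1 ≤ (1 - y / p)⁻¹ * (1 - 1 / (p : ℝ)) ^ y := by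
  have hp0 : (0 : ℝ) < p := by exact_mod_cast (show 0 < p by omega)
  have hs : (-1 : ℝ) ≤ -1 / p := by
    rw [neg_div, neg_le_neg_iff, div_le_one hp0]
    exact_mod_cast (show 1 ≤ p by omega)
  have hB := one_add_mul_self_le_rpow_one_add hs hy1
  have hB' : 1 - y / p ≤ (1 - 1 / (p : ℝ)) ^ y := by
    have e1 : (1 : ℝ) + y * (-1 / p) = 1 - y / p := by ring
    have e2 : (1 : ℝ) + -1 / p = 1 - 1 / p := by ring
    rwa [e1, e2] at hB
  have h1 : 0 < 1 - y / p := by rw [sub_pos, div_lt_one hp0]; exact hyp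
  calc (1 : ℝ) = (1 - y / p)⁻¹ * (1 - y / p) := (inv_mul_cancel₀ h1.ne').symm
    _ ≤ (1 - y / p)⁻¹ * (1 - 1 / (p : ℝ)) ^ y := by
        have : 0 ≤ (1 - y / p)⁻¹ := inv_nonneg.2 h1.le
        gcongr

/-- **LOWER BOUND AT THE WALL**: for real `1 ≤ y < 2`, `Re F(1,y) ≥ ¼ (1 - y/2)⁻¹` (keep the `p = 2` factor
`(1 - y/2)⁻¹ 2^{-y} ≥ ¼ (1 - y/2)⁻¹`, all other factors are real `≥ 1`). So `F(1,y) → +∞` as `y → 2⁻`.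
[cite: MontgomeryVaughan2007, §7.4 (7.60)] -/
theorem re_selbergDelangeOmegaF_ge {y : ℝ} (hy1 : 1 ≤ y) (hy2 : y < 2) :
    1 / 4 * (1 - y / 2)⁻¹ ≤ (selbergDelangeOmegaF y).re := by
  set r : Nat.Primes → ℝ := fun p => (1 - y / p)⁻¹ * (1 - 1 / (p : ℝ)) ^ y with hr
  have hfac : (fun p : Nat.Primes => eulerFactor p 1 (y : ℂ)) = fun p => ((r p : ℝ) : ℂ) :=
    funext fun p => eulerFactor_one_ofReal p y
  have hprod : Tendsto (fun s : Finset Nat.Primes => ∏ p ∈ s, ((r p : ℝ) : ℂ)) atTop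
      (𝓝 (selbergDelangeOmegaF y)) := by
    have h := hasProd_bigOmegaF (y : ℂ) (s := 1) (by norm_num)
    rw [bigOmegaF_one, hfac] at h
    exact h
  have ht : Tendsto (fun s : Finset Nat.Primes => ∏ p ∈ s, r p) atTop (𝓝 (selbergDelangeOmegaF y).re) := by
    have := (Complex.continuous_re.tendsto _).comp hprod
    refine this.congr fun s => ?_
    simp only [Function.comp_apply]
    rw [← Complex.ofReal_prod, Complex.ofReal_re]
  set two : Nat.Primes := ⟨2, Nat.prime_two⟩ with htwo
  have hr1 : ∀ p : Nat.Primes, p ≠ two → 1 ≤ r p := by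
    intro p hp
    have hp2 : (2 : ℕ) ≤ p := p.prop.two_le
    have hp3 : (3 : ℕ) ≤ p := by
      rcases Nat.lt_or_ge (p : ℕ) 3 with h | h
      · exfalso
        apply hp
        have : (p : ℕ) = 2 := by omega
        exact Subtype.ext this
      · exact h
    have hyp : y < ((p : ℕ) : ℝ) := by
      have : (3 : ℝ) ≤ ((p : ℕ) : ℝ) := by exact_mod_cast hp3
      linarith
    exact one_le_realEulerFactor hp2 hy1 hyp
  have hr2 : 1 / 4 * (1 - y / 2)⁻¹ ≤ r two := by
    have hpow : (1 / 4 : ℝ) ≤ (1 - 1 / ((2 : ℕ) : ℝ)) ^ y := by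
      have e : (1 - 1 / ((2 : ℕ) : ℝ)) = 1 / 2 := by norm_num
      rw [e]
      calc (1 / 4 : ℝ) = (1 / 2) ^ ((2 : ℕ) : ℝ) := by rw [Real.rpow_natCast]; norm_num
        _ ≤ (1 / 2) ^ y := Real.rpow_le_rpow_of_exponent_ge (by norm_num) (by norm_num)
            (by push_cast; linarith)
    have hinv : 0 ≤ (1 - y / ((2 : ℕ) : ℝ))⁻¹ := by
      rw [inv_nonneg, sub_nonneg, div_le_one (by norm_num)]
      push_cast; linarith
    have e2 : (1 - y / 2)⁻¹ = (1 - y / ((2 : ℕ) : ℝ))⁻¹ := by norm_num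
    rw [e2]
    calc 1 / 4 * (1 - y / ((2 : ℕ) : ℝ))⁻¹ = (1 - y / ((2 : ℕ) : ℝ))⁻¹ * (1 / 4) := by ring
      _ ≤ (1 - y / ((2 : ℕ) : ℝ))⁻¹ * (1 - 1 / ((2 : ℕ) : ℝ)) ^ y := by gcongr
      _ = r two := by simp only [hr, htwo]
  refine ge_of_tendsto ht ?_
  filter_upwards [eventually_ge_atTop ({two} : Finset Nat.Primes)] with s hs
  have hmem : two ∈ s := hs (Finset.mem_singleton_self two)
  rw [← Finset.mul_prod_erase s r hmem]
  have hone : (1 : ℝ) ≤ ∏ p ∈ s.erase two, r p := by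
    calc (1 : ℝ) = ∏ _p ∈ s.erase two, (1 : ℝ) := by simp
      _ ≤ ∏ p ∈ s.erase two, r p :=
          Finset.prod_le_prod (fun _ _ => zero_le_one) fun p hp => hr1 p (Finset.ne_of_mem_erase hp)
  have hr2pos : 0 ≤ r two := le_trans (by
    have : 0 ≤ (1 - y / 2)⁻¹ := by rw [inv_nonneg]; linarith
    positivity) hr2
  calc 1 / 4 * (1 - y / 2)⁻¹ ≤ r two * 1 := by rw [mul_one]; exact hr2
    _ ≤ r two * ∏ p ∈ s.erase two, r p := by gcongr

/-- **THE HOLOMORPHY RADIUS `2` IS SHARP** (refuted strengthening): the crux with `Metric.ball 0 2` replaced by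
`Metric.ball 0 R` for ANY `R > 2` (segment `(5/4, 7/4)` and pin `Λ 0 = C(f)` unchanged) is FALSE. Witness `k = 1`,
`f = X`: a witness `Λ` must coincide with Selberg's `F(1,·)` on `|z| < 2` (rigidity, §7c), `Re F(1,y) ≥ ¼(1 - y/2)⁻¹ → ∞`
as `y → 2⁻` (the pole of the `p = 2` factor `(1 - z/2)⁻¹`), contradicting the continuity of `Λ` at `2 ∈ ball 0 R`. With
§5 (`y ≤ 2`, `y < b`, `b > 2` all fail on the `H_x` side) this closes the audit of the constant `2`: it is sharp in BOTH
places it occurs. [cite: MontgomeryVaughan2007, §7.4 (7.60) and p. 179] -/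
theorem not_lsdRealSegment_ball {R : ℝ} (hR : 2 < R) :
    ¬ ∀ (k : ℕ) (f : Fin k → ℤ[X]), IsBatemanHornSystem f → ∃ Λ : ℂ → ℂ, DifferentiableOn ℂ Λ (Metric.ball 0 R) ∧
      Λ 0 = (batemanHornConst f : ℂ) ∧ ∀ y : ℝ, 5 / 4 < y → y < 7 / 4 →
        Filter.Tendsto (fun x : ℕ => (x : ℂ)⁻¹
            * Complex.exp ((k : ℂ) * (1 - (y : ℂ)) * (Real.log (Real.log x) : ℂ)) *
          ∑ n ∈ Finset.range (x + 1), (y : ℂ) ^ (∑ i, cardFactors (((f i).eval (n : ℤ)).toNat))) Filter.atTop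
          (nhds (Λ y * Complex.exp (((y : ℂ) - 1) * (Real.log (∏ i, ((f i).natDegree : ℝ)) : ℂ)) *
            (Complex.Gamma y)⁻¹ ^ k)) := by
  intro h
  obtain ⟨Λ, hΛR, -, hlaw⟩ := h 1 ![X] isBatemanHornSystem_X
  have hΛ : DifferentiableOn ℂ Λ (Metric.ball 0 2) := hΛR.mono (Metric.ball_subset_ball hR.le)
  have hlaw' : SegmentLaw 1 ![X] Λ := fun y hy hy' => by simpa [mul_assoc] using hlaw y hy hy'
  have heq := eqOn_selbergDelangeOmegaF_of_segmentLaw_X hΛ hlaw'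
  have h2mem : (2 : ℂ) ∈ Metric.ball (0 : ℂ) R := by
    rw [Metric.mem_ball, dist_zero_right]
    simpa using hR
  have hcont : ContinuousAt Λ 2 := (hΛR.differentiableAt (Metric.isOpen_ball.mem_nhds h2mem)).continuousAt
  obtain ⟨δ, hδ, hB⟩ : ∃ δ > 0, ∀ z : ℂ, dist z 2 < δ → ‖Λ z‖ < ‖Λ 2‖ + 1 := by
    obtain ⟨δ, hδ, h⟩ := Metric.continuousAt_iff.1 hcont 1 one_pos
    refine ⟨δ, hδ, fun z hz => ?_⟩
    have h1 : dist (Λ z) (Λ 2) < 1 := h hz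
    rw [dist_eq_norm] at h1
    calc ‖Λ z‖ = ‖Λ 2 + (Λ z - Λ 2)‖ := by congr 1; ring
      _ ≤ ‖Λ 2‖ + ‖Λ z - Λ 2‖ := norm_add_le _ _
      _ < ‖Λ 2‖ + 1 := by linarith
  set B : ℝ := ‖Λ 2‖ + 1 with hBdef
  have hB0 : 0 < B := by positivity
  set t : ℝ := min (δ / 2) (min (1 / 2) (1 / (8 * B))) with ht
  have ht0 : 0 < t := by positivity
  have htδ : t < δ := (min_le_left _ _).trans_lt (half_lt_self hδ)
  have ht2 : t ≤ 1 / 2 := (min_le_right _ _).trans (min_le_left _ _)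
  have htB : t ≤ 1 / (8 * B) := (min_le_right _ _).trans (min_le_right _ _)
  set y : ℝ := 2 - t with hy
  have hy1 : 1 ≤ y := by rw [hy]; linarith
  have hy2 : y < 2 := by rw [hy]; linarith
  have hyball : ((y : ℝ) : ℂ) ∈ Metric.ball (0 : ℂ) 2 := by
    rw [Metric.mem_ball, dist_zero_right, Complex.norm_real, Real.norm_eq_abs, abs_of_nonneg (by linarith)]
    exact hy2
  have hΛy : Λ y = selbergDelangeOmegaF y := heq hyball
  have hlow := re_selbergDelangeOmegaF_ge hy1 hy2
  have hdist : dist ((y : ℝ) : ℂ) 2 < δ := by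
    rw [dist_eq_norm, show ((y : ℝ) : ℂ) - 2 = ((y - 2 : ℝ) : ℂ) by push_cast; ring, Complex.norm_real,
      Real.norm_eq_abs, hy, show 2 - t - 2 = -t by ring, abs_neg, abs_of_pos ht0]
    exact htδ
  have hup : ‖Λ y‖ < B := hB _ hdist
  have hre : (selbergDelangeOmegaF y).re ≤ ‖Λ y‖ := by rw [hΛy]; exact Complex.re_le_norm _
  have hval : 1 / 4 * (1 - y / 2)⁻¹ = 1 / (2 * t) := by
    rw [hy, show 1 - (2 - t) / 2 = t / 2 by ring]
    have ht0' : t ≠ 0 := ht0.ne'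
    field_simp
    norm_num
  have h4B : 4 * B ≤ 1 / (2 * t) := by
    have h1 : 2 * t ≤ 1 / (4 * B) := by
      calc 2 * t ≤ 2 * (1 / (8 * B)) := by linarith
        _ = 1 / (4 * B) := by field_simp; ring
    calc 4 * B = 1 / (1 / (4 * B)) := by field_simp
      _ ≤ 1 / (2 * t) := one_div_le_one_div_of_le (by positivity) h1
  linarith


/-! ### §7e (cycle 2) The first non-monic rung `f = 2X + 1` (landed as `Theorems/LSDRealSegment/Negative/OddLinear.lean`, p79612;
reproduced here so that the work file stays self-contained)

The exact dyadic identity `A_y(X) = O_y(X) + y·A_y(⌊X/2⌋)` (`O` = odd part) gives `Σ_{n ≤ x} y^{Ω(2n+1)} = A_y(2x+1) - y A_y(x)`;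
Selberg's theorem at `2x + 1` and at `x` gives `H_x(y) → (2 - y) F(1,y)/Γ(y)` for every real `1 ≤ y < 2`; `(2X+1)` is a
Bateman–Horn system (Gauss's lemma; `ω(2) = 0`, `ω(p) = 1` for odd `p`) with `C(2X+1) = 2`. -/


/-! #### The dyadic identity -/

/-- `Ω(2m) = 1 + Ω(m)` for `m ≠ 0`. [folklore] -/
theorem cardFactors_two_mul {m : ℕ} (hm : m ≠ 0) : cardFactors (2 * m) = 1 + cardFactors m := by
  rw [ArithmeticFunction.cardFactors_mul two_ne_zero hm, ArithmeticFunction.cardFactors_apply_prime Nat.prime_two]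

/-- The even numbers of `[1, X]` are `{2m : m ∈ [1, X/2]}`. [folklore] -/
theorem filter_even_Icc_eq_image (X : ℕ) :
    (Icc 1 X).filter (fun m => ¬Odd m) = (Icc 1 (X / 2)).image fun m => 2 * m := by
  ext n
  simp only [Finset.mem_filter, Finset.mem_Icc, Finset.mem_image, Nat.not_odd_iff_even]
  constructor
  · rintro ⟨⟨h1, hX⟩, ⟨c, rfl⟩⟩
    exact ⟨c, ⟨by omega, by omega⟩, by omega⟩
  · rintro ⟨c, ⟨hc1, hcX⟩, rfl⟩
    exact ⟨⟨by omega, by omega⟩, ⟨c, by ring⟩⟩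

/-- **`A_y(X) = O_y(X) + y · A_y(⌊X/2⌋)`** (split `[1, X]` into odd and even `m = 2m'`, `Ω(2m') = 1 + Ω(m')`). [folklore] -/
theorem sum_cardFactors_Icc_eq_odd_add (w : ℂ) (X : ℕ) :
    ∑ m ∈ Icc 1 X, w ^ cardFactors m =
      ∑ m ∈ (Icc 1 X).filter Odd, w ^ cardFactors m + w * ∑ m ∈ Icc 1 (X / 2), w ^ cardFactors m := by
  rw [← Finset.sum_filter_add_sum_filter_not (Icc 1 X) Odd, filter_even_Icc_eq_image,
    Finset.sum_image fun a _ b _ (h : 2 * a = 2 * b) => by omega, Finset.mul_sum]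
  congr 1
  refine Finset.sum_congr rfl fun m hm => ?_
  rw [Finset.mem_Icc] at hm
  rw [cardFactors_two_mul (by omega), pow_add, pow_one]

/-- The odd numbers of `[1, 2x+1]` are `{2n+1 : n ∈ range (x+1)}`. [folklore] -/
theorem filter_odd_Icc_eq_image_range (x : ℕ) :
    (Icc 1 (2 * x + 1)).filter Odd = (Finset.range (x + 1)).image fun n => 2 * n + 1 := by
  ext m
  simp only [Finset.mem_filter, Finset.mem_Icc, Finset.mem_image, Finset.mem_range]
  constructor
  · rintro ⟨⟨h1, hX⟩, ⟨c, rfl⟩⟩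
    exact ⟨c, by omega, rfl⟩
  · rintro ⟨c, hc, rfl⟩
    exact ⟨⟨by omega, by omega⟩, ⟨c, rfl⟩⟩

/-- The crux's sum for `f = 2X + 1` is the odd sum `O(2x+1) = A(2x+1) - y A(x)`. [folklore] -/
theorem sum_twoX_add_one_eq (x : ℕ) (w : ℂ) :
    ∑ n ∈ Finset.range (x + 1), w ^ (∑ i, cardFactors ((((![C 2 * X + C 1] : Fin 1 → ℤ[X]) i).eval (n : ℤ)).toNat)) =
      ∑ m ∈ Icc 1 (2 * x + 1), w ^ cardFactors m - w * ∑ m ∈ Icc 1 x, w ^ cardFactors m := by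
  have h : ∀ n : ℕ, (∑ i, cardFactors ((((![C 2 * X + C 1] : Fin 1 → ℤ[X]) i).eval (n : ℤ)).toNat)) =
      cardFactors (2 * n + 1) := fun n => by
    simp only [Fin.sum_univ_one, Matrix.cons_val_fin_one, eval_add, eval_mul, eval_C, eval_X]
    have : (2 * (n : ℤ) + 1) = ((2 * n + 1 : ℕ) : ℤ) := by push_cast; ring
    rw [this, Int.toNat_natCast]
  simp_rw [h]
  rw [sum_cardFactors_Icc_eq_odd_add w (2 * x + 1), filter_odd_Icc_eq_image_range,
    Finset.sum_image fun a _ b _ (h : 2 * a + 1 = 2 * b + 1) => by omega,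
    show (2 * x + 1) / 2 = x by omega]
  ring

/-! #### `(2X + 1)` is a Bateman–Horn system with `ω(2) = 0`, `ω(p) = 1` (`p` odd), `C(2X+1) = 2` -/

/-- `p ∣ 2n+1` with `n < p`: only `2n + 1 = p`. So `ω_{2X+1}(p) = 1` for odd primes and `= 0` for `p = 2`. [folklore] -/
theorem polyRootCountMod_twoX_add_one {p : ℕ} (hp : p.Prime) :
    polyRootCountMod (![C 2 * X + C 1] : Fin 1 → ℤ[X]) p = if p = 2 then 0 else 1 := by
  unfold polyRootCountMod
  have hdvd : ∀ n : ℕ, ((p : ℤ) ∣ ∏ i, ((![C 2 * X + C 1] : Fin 1 → ℤ[X]) i).eval (n : ℤ)) ↔ p ∣ 2 * n + 1 := by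
    intro n
    simp only [Fin.prod_univ_one, Matrix.cons_val_fin_one, eval_add, eval_mul, eval_C, eval_X]
    have : (2 * (n : ℤ) + 1) = ((2 * n + 1 : ℕ) : ℤ) := by push_cast; ring
    rw [this, Int.natCast_dvd_natCast]
  simp_rw [hdvd]
  split_ifs with h2
  · subst h2
    rw [Finset.card_eq_zero, Finset.filter_eq_empty_iff]
    intro n _ h
    omega
  · have hodd : Odd p := hp.odd_of_ne_two h2
    obtain ⟨c, hc⟩ := hodd
    rw [Finset.card_eq_one]
    refine ⟨c, ?_⟩
    ext n
    simp only [Finset.mem_filter, Finset.mem_range, Finset.mem_singleton]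
    constructor
    · rintro ⟨hn, t, ht⟩
      have ht1 : t = 1 := by
        rcases Nat.lt_or_ge t 2 with h | h
        · interval_cases t
          · omega
          · rfl
        · nlinarith [hp.two_le]
      subst ht1
      omega
    · rintro rfl
      exact ⟨by omega, ⟨1, by omega⟩⟩

/-- `(2X + 1)` is a Bateman–Horn system. [folklore] -/
theorem isBatemanHornSystem_twoX_add_one : IsBatemanHornSystem (![C 2 * X + C 1] : Fin 1 → ℤ[X]) where
  irreducible i := by
    have hprim : (C 2 * X + C 1 : ℤ[X]).IsPrimitive := by
      rw [Polynomial.isPrimitive_iff_isUnit_of_C_dvd]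
      intro r hr
      have h0 := (Polynomial.C_dvd_iff_dvd_coeff r _).1 hr 0
      simp at h0
      exact isUnit_of_dvd_one h0
    have hirr : Irreducible ((C 2 * X + C 1 : ℤ[X]).map (algebraMap ℤ ℚ)) := by
      simp only [Polynomial.map_add, Polynomial.map_mul, Polynomial.map_C, Polynomial.map_X]
      exact Polynomial.irreducible_of_degree_eq_one (Polynomial.degree_linear (by norm_num))
    simpa using (hprim.irreducible_iff_irreducible_map_fraction_map (K := ℚ)).2 hirr
  leadingCoeff_pos i := by
    simp only [Matrix.cons_val_fin_one]
    rw [Polynomial.leadingCoeff_linear (by norm_num)]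
    norm_num
  pairwise_not_associated := Subsingleton.pairwise
  hasNoFixedPrimeDivisor p hp := by
    rw [polyRootCountMod_twoX_add_one hp]
    split_ifs with h
    · exact hp.pos
    · exact hp.one_lt

/-- `C(2X + 1) = 2` (`= q/φ(q)` with `q = 2`): the partial products equal `2` from `x = 2` on. [folklore] -/
theorem batemanHornConst_twoX_add_one : batemanHornConst (![C 2 * X + C 1] : Fin 1 → ℤ[X]) = 2 := by
  have hpart : ∀ x : ℕ, 2 ≤ x → batemanHornPartial (![C 2 * X + C 1] : Fin 1 → ℤ[X]) x = 2 := by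
    intro x hx
    unfold batemanHornPartial
    have h2 : 2 ∈ Nat.primesLE x := Nat.mem_primesLE.2 ⟨hx, Nat.prime_two⟩
    rw [← Finset.mul_prod_erase _ _ h2, polyRootCountMod_twoX_add_one Nat.prime_two, if_pos rfl]
    have hrest : ∏ p ∈ (Nat.primesLE x).erase 2,
        (1 - 1 / (p : ℝ))⁻¹ ^ Fintype.card (Fin 1) * (1 - (polyRootCountMod (![C 2 * X + C 1] : Fin 1 → ℤ[X]) p : ℝ) / p)
        = 1 := by
      refine Finset.prod_eq_one fun p hp => ?_
      have hp2 : p ≠ 2 := Finset.ne_of_mem_erase hp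
      have hp' : p.Prime := Nat.prime_of_mem_primesLE (Finset.mem_of_mem_erase hp)
      have hp0 : (0 : ℝ) < p := by exact_mod_cast hp'.pos
      have hlt : 1 / (p : ℝ) < 1 := by rw [div_lt_one hp0]; exact_mod_cast hp'.one_lt
      rw [polyRootCountMod_twoX_add_one hp', if_neg hp2, Fintype.card_fin, pow_one, Nat.cast_one]
      exact inv_mul_cancel₀ (ne_of_gt (by linarith))
    rw [hrest]
    norm_num
  refine HasBatemanHornConst.batemanHornConst_eq ?_
  refine (tendsto_const_nhds (x := (2 : ℝ))).congr' ?_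
  filter_upwards [eventually_ge_atTop 2] with x hx
  exact (hpart x hx).symm

/-! #### The segment law at `f = 2X + 1`: `H_x(y) → (2 - y) F(1,y)/Γ(y)` -/

/-- `log log (2x+1) - log log x → 0`. [folklore] -/
theorem tendsto_loglog_twoX_add_one_sub :
    Tendsto (fun x : ℕ => Real.log (Real.log (2 * x + 1)) - Real.log (Real.log x)) atTop (𝓝 0) := by
  have hlog : Tendsto (fun x : ℕ => Real.log x) atTop atTop := Real.tendsto_log_atTop.comp tendsto_natCast_atTop_atTop
  have hratio : Tendsto (fun x : ℕ => Real.log (2 * x + 1) / Real.log x) atTop (𝓝 1) := by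
    have hnum : Tendsto (fun x : ℕ => Real.log (2 + (x : ℝ)⁻¹)) atTop (𝓝 (Real.log 2)) := by
      have : Tendsto (fun x : ℕ => 2 + (x : ℝ)⁻¹) atTop (𝓝 2) := by
        simpa using tendsto_const_nhds.add (tendsto_inv_atTop_nhds_zero_nat (𝕜 := ℝ))
      exact (Real.continuousAt_log (by norm_num)).tendsto.comp this
    have hquot : Tendsto (fun x : ℕ => Real.log (2 + (x : ℝ)⁻¹) / Real.log x) atTop (𝓝 0) :=
      hnum.div_atTop hlog
    have h1 : Tendsto (fun x : ℕ => 1 + Real.log (2 + (x : ℝ)⁻¹) / Real.log x) atTop (𝓝 1) := by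
      simpa using tendsto_const_nhds.add hquot
    refine h1.congr' ?_
    filter_upwards [eventually_ge_atTop 2] with x hx
    have hx0 : (0 : ℝ) < x := by exact_mod_cast (show 0 < x by omega)
    have hlx : Real.log x ≠ 0 := by
      have : 1 < (x : ℝ) := by exact_mod_cast (show 1 < x by omega)
      exact (Real.log_pos this).ne'
    have hsplit : Real.log (2 * x + 1) = Real.log x + Real.log (2 + (x : ℝ)⁻¹) := by
      rw [← Real.log_mul hx0.ne' (by positivity)]
      congr 1
      field_simp
    rw [hsplit]
    field_simp
  have h := (Real.continuousAt_log one_ne_zero).tendsto.comp hratio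
  rw [Real.log_one] at h
  refine h.congr' ?_
  filter_upwards [eventually_ge_atTop 2] with x hx
  have hx1 : (1 : ℝ) < x := by exact_mod_cast (show 1 < x by omega)
  have hlx : 0 < Real.log x := Real.log_pos hx1
  have hl2 : 0 < Real.log (2 * x + 1) := Real.log_pos (by linarith)
  simp only [Function.comp_apply]
  rw [Real.log_div hl2.ne' hlx.ne']

/-- **SEGMENT LAW AT `f = 2X + 1`** (for every real `1 ≤ y < 2`):
`x⁻¹ (log x)^{1-y} Σ_{n ≤ x} y^{Ω(2n+1)} → (2 - y) F(1,y)/Γ(y)` (dyadic identity + Selberg's theorem at `2x+1` and at `x`).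
[cite: MontgomeryVaughan2007, §7.4 Theorem 7.18 and (7.60)] -/
theorem tendsto_normSum_twoX_add_one {y : ℝ} (hy1 : 1 ≤ y) (hy2 : y < 2) :
    Tendsto (fun x : ℕ => (x : ℂ)⁻¹ * Complex.exp (((1 : ℕ) : ℂ) * (1 - (y : ℂ)) * (Real.log (Real.log x) : ℂ)) *
      ∑ n ∈ Finset.range (x + 1), (y : ℂ) ^ (∑ i, cardFactors ((((![C 2 * X + C 1] : Fin 1 → ℤ[X]) i).eval (n : ℤ)).toNat)))
      atTop (𝓝 ((2 - (y : ℂ)) * selbergDelangeOmegaF y * (Complex.Gamma y)⁻¹)) := by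
  obtain ⟨K, hK⟩ := MontgomeryVaughan2007_thm_7_18_Omega_holds y hy2
  set w : ℂ := (y : ℂ) with hw
  set G : ℂ := selbergDelangeOmegaF w * (Complex.Gamma w)⁻¹ with hG
  have hwn : ‖w‖ ≤ y := by rw [hw, Complex.norm_real, Real.norm_eq_abs, abs_of_nonneg (by linarith)]
  set A : ℕ → ℂ := fun X => ∑ m ∈ Icc 1 X, w ^ cardFactors m with hA
  set e : ℕ → ℂ := fun x => Complex.exp (((1 : ℕ) : ℂ) * (1 - w) * (Real.log (Real.log x) : ℂ)) with he
  set ρ : ℕ → ℂ := fun x => e x * (((Real.log (2 * x + 1) : ℝ) : ℂ) ^ (w - 1)) with hρ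
  set Err : ℕ → ℂ := fun x => (x : ℂ)⁻¹ * e x *
      ((A (2 * x + 1) - G * ((2 * x + 1 : ℕ) : ℂ) * ((Real.log (2 * x + 1) : ℝ) : ℂ) ^ (w - 1)) -
        w * (A x - G * (x : ℂ) * ((Real.log x : ℝ) : ℂ) ^ (w - 1))) with hErr
  have hdecomp : ∀ x : ℕ, 3 ≤ x →
      (x : ℂ)⁻¹ * e x * ∑ n ∈ Finset.range (x + 1), w ^ (∑ i, cardFactors ((((![C 2 * X + C 1] : Fin 1
          → ℤ[X]) i).eval (n : ℤ)).toNat)) =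
        (2 - w) * G + (Err x + G * ((2 + (x : ℂ)⁻¹) * ρ x - 2)) := by
    intro x hx
    have hx0 : (0 : ℝ) < x := by exact_mod_cast (show 0 < x by omega)
    have hL : 0 < Real.log x := Real.log_pos (by exact_mod_cast (show 1 < x by omega))
    have he1 : e x * (((Real.log x : ℝ) : ℂ) ^ (w - 1)) = 1 := exp_mul_cpow_eq_one hL w
    have hxne : (x : ℂ) ≠ 0 := by exact_mod_cast (show (x : ℕ) ≠ 0 by omega)
    have hxinv : (x : ℂ)⁻¹ * (x : ℂ) = 1 := inv_mul_cancel₀ hxne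
    have hcast : ((2 * x + 1 : ℕ) : ℂ) = 2 * (x : ℂ) + 1 := by push_cast; ring
    rw [sum_twoX_add_one_eq]
    simp only [hErr, hρ, hA, hcast]
    linear_combination (2 * G * e x * (((Real.log (2 * (x : ℝ) + 1) : ℝ) : ℂ) ^ (w - 1)) - w * G) * hxinv
      + (-(w * G) * ((x : ℂ)⁻¹ * (x : ℂ))) * he1
  have hErr0 : Tendsto Err atTop (𝓝 0) := by
    have hbound : ∀ x : ℕ, 3 ≤ x → ‖Err x‖ ≤ 5 * max K 0 * (Real.log x) ^ (-(2 - y)) := by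
      intro x hx
      have hx0 : (0 : ℝ) < x := by exact_mod_cast (show 0 < x by omega)
      have hx2 : (2 : ℝ) ≤ x := by exact_mod_cast (show 2 ≤ x by omega)
      have hx2' : (2 : ℝ) ≤ ((2 * x + 1 : ℕ) : ℝ) := by push_cast; linarith
      have hL1 : 1 < Real.log x := by
        rw [Real.lt_log_iff_exp_lt hx0]
        have := Real.exp_one_lt_d9
        have h3 : (3 : ℝ) ≤ x := by exact_mod_cast hx
        linarith
      have hL : 0 < Real.log x := by linarith
      have hLL : Real.log x ≤ Real.log (2 * x + 1) := Real.log_le_log hx0 (by linarith)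
      have hE1 := hK _ hx2' w hwn
      rw [Nat.floor_natCast] at hE1
      have hE2 := hK x hx2 w hwn
      rw [Nat.floor_natCast] at hE2
      have hcast : (((2 * x + 1 : ℕ) : ℝ)) = 2 * (x : ℝ) + 1 := by push_cast; ring
      rw [hcast] at hE1
      have hK0 : K ≤ max K 0 := le_max_left _ _
      have hM0 : 0 ≤ max K 0 := le_max_right _ _
      have hpow1 : Real.log (2 * x + 1) ^ (y - 2) ≤ Real.log x ^ (y - 2) :=
        Real.rpow_le_rpow_of_nonpos hL hLL (by linarith)
      have hne : ‖e x‖ ≤ 1 := norm_exp_normaliser_le_one hL1.le hy1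
      have hxinvR : ‖(x : ℂ)⁻¹‖ = (x : ℝ)⁻¹ := by simp
      have hwn' : ‖w‖ ≤ 2 := hwn.trans hy2.le
      have h1 : ‖A (2 * x + 1) - G * ((2 * x + 1 : ℕ) : ℂ) * ((Real.log (2 * x + 1) : ℝ) : ℂ) ^ (w - 1)‖ ≤
          max K 0 * (2 * x + 1) * Real.log x ^ (y - 2) := by
        have : ((2 * x + 1 : ℕ) : ℂ) = (((2 * (x : ℝ) + 1 : ℝ)) : ℂ) := by push_cast; ring
        rw [hA, this]
        refine hE1.trans ?_
        have h01 : (0 : ℝ) ≤ 2 * x + 1 := by positivity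
        calc K * (2 * (x : ℝ) + 1) * Real.log (2 * x + 1) ^ (w.re - 2)
            ≤ max K 0 * (2 * x + 1) * Real.log (2 * x + 1) ^ (w.re - 2) := by
              gcongr
              exact Real.rpow_nonneg (by linarith [hLL]) _
          _ ≤ max K 0 * (2 * x + 1) * Real.log x ^ (y - 2) := by
              have hre : w.re = y := by simp [hw]
              rw [hre]
              gcongr
      have h2 : ‖A x - G * (x : ℂ) * ((Real.log x : ℝ) : ℂ) ^ (w - 1)‖ ≤ max K 0 * x * Real.log x ^ (y - 2) := by
        rw [hA]
        refine hE2.trans ?_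
        have hre : w.re = y := by simp [hw]
        rw [hre]
        gcongr
      calc ‖Err x‖ = (x : ℝ)⁻¹ * ‖e x‖ * ‖(A (2 * x + 1) - G * ((2 * x + 1 : ℕ) : ℂ) *
              ((Real.log (2 * x + 1) : ℝ) : ℂ) ^ (w - 1)) - w * (A x - G * (x : ℂ) * ((Real.log x : ℝ) : ℂ) ^ (w - 1))‖ := by
            rw [hErr]; simp only; rw [norm_mul, norm_mul, hxinvR]
        _ ≤ (x : ℝ)⁻¹ * 1 * (max K 0 * (2 * x + 1) * Real.log x ^ (y - 2) + 2 * (max K 0 * x * Real.log x ^ (y - 2))) := by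
            gcongr
            refine (norm_sub_le _ _).trans ?_
            gcongr
            rw [norm_mul]
            gcongr
        _ = max K 0 * Real.log x ^ (y - 2) * ((x : ℝ)⁻¹ * (4 * x + 1)) := by ring
        _ ≤ max K 0 * Real.log x ^ (y - 2) * 5 := by
            have hnn : 0 ≤ max K 0 * Real.log x ^ (y - 2) := mul_nonneg hM0 (Real.rpow_nonneg hL.le _)
            gcongr
            rw [inv_mul_le_iff₀ hx0]
            have h3 : (3 : ℝ) ≤ x := by exact_mod_cast hx
            linarith
        _ = 5 * max K 0 * Real.log x ^ (-(2 - y)) := by rw [show y - 2 = -(2 - y) by ring]; ring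
    have hrhs : Tendsto (fun x : ℕ => 5 * max K 0 * (Real.log x) ^ (-(2 - y))) atTop (𝓝 0) := by
      have h2 : Tendsto (fun x : ℕ => (Real.log x) ^ (-(2 - y))) atTop (𝓝 0) :=
        (tendsto_rpow_neg_atTop (by linarith : 0 < 2 - y)).comp
          (Real.tendsto_log_atTop.comp tendsto_natCast_atTop_atTop)
      simpa using h2.const_mul (5 * max K 0)
    refine squeeze_zero_norm' ?_ hrhs
    filter_upwards [eventually_ge_atTop 3] with x hx
    exact hbound x hx
  have hρ1 : Tendsto ρ atTop (𝓝 1) := by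
    have hform : ∀ x : ℕ, 3 ≤ x → ρ x = Complex.exp ((w - 1) *
        ((Real.log (Real.log (2 * x + 1)) - Real.log (Real.log x) : ℝ) : ℂ)) := by
      intro x hx
      have hx0 : (0 : ℝ) < x := by exact_mod_cast (show 0 < x by omega)
      have hL1pos : 0 < Real.log (2 * (x : ℝ) + 1) := Real.log_pos (by
        have : (1 : ℝ) ≤ x := by exact_mod_cast (show 1 ≤ x by omega)
        linarith)
      rw [hρ, he]
      simp only
      rw [Complex.cpow_def_of_ne_zero (by exact_mod_cast hL1pos.ne'), ← Complex.ofReal_log hL1pos.le,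
        ← Complex.exp_add]
      congr 1
      push_cast
      ring
    have hlim : Tendsto (fun x : ℕ => Complex.exp ((w - 1) *
        ((Real.log (Real.log (2 * x + 1)) - Real.log (Real.log x) : ℝ) : ℂ))) atTop (𝓝 1) := by
      have h0 := tendsto_loglog_twoX_add_one_sub
      have h1 : Tendsto (fun x : ℕ => (w - 1) * ((Real.log (Real.log (2 * x + 1)) - Real.log (Real.log x) : ℝ) : ℂ))
          atTop (𝓝 0) := by
        have := (Complex.continuous_ofReal.tendsto 0).comp h0
        simpa using this.const_mul (w - 1)
      have h2 := (Complex.continuous_exp.tendsto 0).comp h1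
      rw [Complex.exp_zero] at h2
      exact h2
    refine hlim.congr' ?_
    filter_upwards [eventually_ge_atTop 3] with x hx
    exact (hform x hx).symm
  have hmain : Tendsto (fun x : ℕ => (2 - w) * G + (Err x + G * ((2 + (x : ℂ)⁻¹) * ρ x - 2))) atTop
      (𝓝 ((2 - w) * G)) := by
    have hx0 : Tendsto (fun x : ℕ => (x : ℂ)⁻¹) atTop (𝓝 0) := by
      simpa using tendsto_inv_atTop_nhds_zero_nat (𝕜 := ℂ)
    have h2 : Tendsto (fun x : ℕ => (2 + (x : ℂ)⁻¹) * ρ x - 2) atTop (𝓝 0) := by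
      have := ((tendsto_const_nhds (x := (2 : ℂ))).add hx0).mul hρ1
      simpa using this.sub_const 2
    have h3 : Tendsto (fun x : ℕ => Err x + G * ((2 + (x : ℂ)⁻¹) * ρ x - 2)) atTop (𝓝 0) := by
      simpa using hErr0.add (h2.const_mul G)
    simpa using (tendsto_const_nhds (x := (2 - w) * G)).add h3
  have hmain' := hmain.congr' (f₂ := fun x : ℕ => (x : ℂ)⁻¹ * e x *
      ∑ n ∈ Finset.range (x + 1), w ^ (∑ i, cardFactors ((((![C 2 * X + C 1] : Fin 1 → ℤ[X]) i).eval (n : ℤ)).toNat)))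
    (by filter_upwards [eventually_ge_atTop 3] with x hx; exact (hdecomp x hx).symm)
  simpa [hG, he, mul_assoc] using hmain'

/-- The archimedean factor at `f = 2X + 1` is `Γ(y)⁻¹` (`D = natDegree (2X+1) = 1`). [folklore] -/
theorem archFactor_twoX_add_one (y : ℝ) :
    Complex.exp (((y : ℂ) - 1) * (Real.log (∏ i, (((![C 2 * X + C 1] : Fin 1 → ℤ[X]) i).natDegree : ℝ)) : ℂ)) *
      (Complex.Gamma y)⁻¹ ^ 1 = (Complex.Gamma y)⁻¹ := by
  have hd : ((![C 2 * X + C 1] : Fin 1 → ℤ[X]) 0).natDegree = 1 := by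
    simp only [Matrix.cons_val_fin_one]
    exact Polynomial.natDegree_linear (by norm_num)
  rw [Fin.prod_univ_one, hd]
  simp

/-- The crux's real-segment law HOLDS for `(2X + 1)` with `Λ(z) = (2 - z) F(1,z)` (target in the crux's own shape).
[cite: MontgomeryVaughan2007, §7.4 Theorem 7.18 and (7.60)] -/
theorem omegaSegmentLaw_twoX_add_one (y : ℝ) (hy : 5 / 4 < y) (hy' : y < 7 / 4) :
    Tendsto (fun x : ℕ => (x : ℂ)⁻¹ * Complex.exp (((1 : ℕ) : ℂ) * (1 - (y : ℂ)) * (Real.log (Real.log x) : ℂ)) *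
      ∑ n ∈ Finset.range (x + 1), (y : ℂ) ^ (∑ i, cardFactors ((((![C 2 * X + C 1] : Fin 1 → ℤ[X]) i).eval (n : ℤ)).toNat)))
      atTop (𝓝 ((fun z : ℂ => (2 - z) * selbergDelangeOmegaF z) y * (Complex.exp (((y : ℂ) - 1) *
        (Real.log (∏ i, (((![C 2 * X + C 1] : Fin 1 → ℤ[X]) i).natDegree : ℝ)) : ℂ)) * (Complex.Gamma y)⁻¹ ^ 1))) := by
  rw [archFactor_twoX_add_one]
  exact tendsto_normSum_twoX_add_one (y := y) (by linarith) (by linarith)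

/-- **THE CRUX HOLDS AT `f = 2X + 1`** with `Λ(z) = (2 - z) F(1,z)`: holomorphic on `|z| < 2`, `Λ 0 = 2 F(1,0) = 2 =
C(2X+1)` (the pin checked at a value `≠ 1`), and the segment law is `tendsto_normSum_twoX_add_one`. The factor `2 - z`
CANCELS the pole of `F(1,·)` at `2` (odd values have no factor `2`: `E_2 ≡ 1` for this system), so this `Λ` extends
holomorphically to `|z| < 3` and the law survives up to `y < 3`: the wall at `2` of `WallAtTwo*` / `SharpRadius` is the `p = 2`
Euler factor of the SYSTEM `f = X`, not a universal feature — the `∀ f` strengthenings are refuted through `f = X` only.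
[cite: MontgomeryVaughan2007, §7.4 Theorem 7.18 and (7.60)] -/
theorem lsdRealSegment_conclusion_twoX_add_one :
    ∃ Λ : ℂ → ℂ, DifferentiableOn ℂ Λ (Metric.ball 0 2) ∧ Λ 0 = (batemanHornConst (![C 2 * X + C 1] : Fin 1 → ℤ[X]) : ℂ) ∧
      ∀ y : ℝ, 5 / 4 < y → y < 7 / 4 → Filter.Tendsto (fun x : ℕ => (x : ℂ)⁻¹ *
        Complex.exp (((1 : ℕ) : ℂ) * (1 - (y : ℂ)) * (Real.log (Real.log x) : ℂ)) *
        ∑ n ∈ Finset.range (x + 1), (y : ℂ) ^ (∑ i, cardFactors ((((![C 2 * X + C 1] : Fin 1 → ℤ[X]) i).eval (n : ℤ)).toNat)))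
        Filter.atTop (nhds (Λ y * Complex.exp (((y : ℂ) - 1) *
          (Real.log (∏ i, (((![C 2 * X + C 1] : Fin 1 → ℤ[X]) i).natDegree : ℝ)) : ℂ)) * (Complex.Gamma y)⁻¹ ^ 1)) := by
  refine ⟨fun z => (2 - z) * selbergDelangeOmegaF z, ?_, ?_, fun y hy hy' => ?_⟩
  · exact ((differentiableOn_const (2 : ℂ)).sub differentiableOn_id).mul differentiableOn_selbergDelangeOmegaF
  · simp only [sub_zero, selbergDelangeOmegaF_zero, mul_one, batemanHornConst_twoX_add_one]
    norm_num
  · have := omegaSegmentLaw_twoX_add_one y hy hy'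
    simpa [mul_assoc] using this

/-- … which is literally the `k = 1`, `f = 2X + 1` case of the route decl. -/
example (h : Summit.Parity.BatemanHorn.Theses.SelbergDelangeRigidity.LSDRealSegment) :=
  h 1 (![C 2 * X + C 1] : Fin 1 → ℤ[X]) isBatemanHornSystem_twoX_add_one


/-- `Conclusion 1 (2X+1)`: **THE CRUX HOLDS AT `f = 2X + 1`** — the pin `Λ 0 = C(f)` certified at a value `≠ 1` (a
multiplicative slip — `q/φ(q)`, a power of `D`, a stray `e^{γ}` — at `z = 0` would have survived `f = X` and dies here).
[cite: MontgomeryVaughan2007, §7.4 Theorem 7.18 and (7.60)] -/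
theorem conclusion_twoX_add_one : Conclusion 1 ![C 2 * X + C 1] := lsdRealSegment_conclusion_twoX_add_one

/-! ## §8 Cycle-2 analysis (refuter-cdisprove-stmt-Parity-9770-g2-0, 2026-08-16)

**(a) The linear rungs `f = X` and `f = 2X + 1` are now theorems, and they certify the typing.** §7 proves the crux's conclusion for `f = X` (and §7e for `f = 2X+1`, pin `2`)
from the tree's (fully proved) Selberg–Delange law, with the crux's exact normalisation and junk terms, and shows the
witness is rigid (`Λ = F(1,·)`, `Λ 0 = 1 = C(X)` forced). Consequently every misstatement attack on the SHAPE of the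
conclusion (`x⁻¹`, the `exp(k(1-y) log log x)` normaliser, `D^{y-1}`, `Γ(y)^{-k}`, the pin, `Finset.range (x+1)`,
`Int.toNat`, `Real.log (Real.log x)` at `x ≤ 2`) is dead: any of them would contradict `conclusion_X`. What is left
open is exactly `Σ deg f_i ≥ 2` (one quadratic) and `k ≥ 2` (two linear forms) upward — as the planner said.

**(b) Correction to the route rationale: `Λ(y)` is NOT parity-blind for `Σ_i deg f_i ≥ 3` or `k ≥ 2`.** The route text
says the real-segment law is "parity-invisible at leading order since `1 ± λ` reweightings move `H_x(z)` by
`(log x)^{-2k Re z}`". That estimate covers only the FULL twist `λ(∏ f_i(n))` (all prime factors flipped: `y ↦ -y`).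
Partial twists are of leading order. Write `f_i(n) = a_i b_i` with `a_i` the `x`-smooth and `b_i` the `x`-rough part
(for linear forms use the threshold `x^{1/2}`). The weights are `y^{Ω(a_i)} · y^{Ω(b_i)}` and `Ω(b_i) ∈ {0, …, deg f_i}`
is bounded, so the twist `λ(b_i) = (-1)^{Ω(b_i)}` changes the sum by a factor of order one, not by a power of `log x`.
In the Poisson–Dirichlet model behind the conjectural `λ_f` (prime factors of `f_i(n)` at scale `x^{deg f_i}` follow
`PD(θ = y)` under the `y^{Ω}`-tilt), the tilted mass of `{Ω(b) = 2}` for a cubic (`b = p₁p₂`, both `> x`, versus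
`b` prime in `(x², x³)` — indistinguishable by size) is a positive constant (`(θ²/2)∫∫_{s,t>1/3, s+t<1}(1-s-t)^{θ-1} ds dt/(st) ≈ 0.11` at
`θ = y = 3/2`; `0.147` untilted), and for the twin
system the configuration "`n = m p`, `n + 2 = m' q` with `p, q > x^{1/2}` prime" has tilted mass `≈ q₁(y)²`,
`q₁(3/2) = ∫_{1/2}^1 (3/2)(1-t)^{1/2} dt/t ≈ 0.52` (so ≈ 0.27 of the tilted mass; `log 2 ≈ 0.69` untilted). On these configurations the count IS a prime-detection problem
(`f(n)/a` prime versus `P₂` for `a < x`; prime pairs `(n/m, (n+2)/m')` in the classes `n ≡ 0 (m)`, `n ≡ -2 (m')`),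
entering `Λ(y)` through AVERAGES over the smooth parts with multiplicative weights `y^{Ω(a)} ω_f(a)/a` — Titchmarsh-
divisor / dispersion territory (averaged Hardy–Littlewood densities over moduli `m m'` up to `x`), not fixed-level
Type I. So `LSDRealSegment` carries parity content of the same KIND as `NormalFamilyBound` (only averaged, with
positive weights); `Literature.Barriers.Parity.SelbergParityBarrier` is engaged by it for every member with
`Σ deg f_i ≥ 3` or `k ≥ 2`, contrary to the route's Barriers paragraph. (For ONE QUADRATIC, `b ∈ {1, p}` is
determined by the size of `a`, and the law reduces to the joint law of `(Ω(a_n), log a_n)` of the `x`-smooth part of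
`n² + 1` — smooth values of `n² + 1` with tilted weights: Dickman–de Bruijn along `f`, known only conditionally
(G. Martin 2002 under uniform Bateman–Horn) — no parity, but level `x²` divisor information, the
`arXiv:1908.08816` wall the planner names.) None of this makes the crux FALSE: the model's prediction is the standard
Hardy–Littlewood/Chowla-consistent one; it re-prices the crux (it is not the "soft half" of the route).

**(c) What a substantive counterexample would have to be.** By (a) and §3–§5 it must be a genuine Bateman–Horn system
with `Σ deg ≥ 2` or `k ≥ 2` whose values have large-prime-factor statistics deviating at order one from the
`PD(y)`-with-local-densities model on a positive-tilted-mass set — an anomaly in the anatomy of polynomial values of a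
kind that no known result or heuristic (Chowla, Elliott, Bateman–Horn with uniformity, Dickman–Hooley for `P⁺(n²+1)`)
allows; or a failure of the LIMIT to exist (oscillation of `H_x(y)` at a fixed real `y`), for which positive weights
leave no mechanism short of such an anomaly. I have none; the numerics below look for drift instead.

**(d) Numerics: the route's cheapest falsifier FAILS to falsify; the twins "anomaly" is the control's own rate.**
Exact `Ω` by sieve; ratios `r_f(x,y) = H_x(y)/Ψ_f(y)`, `Ψ_f = λ_f(y)Γ(y)^{-k}` (`D = 1`) with the exact local factors
(`E_2^{twin} = 1/2 + y³/(2(2-y))`, `E_3^{(X,X+6)} = 2/3 + y²/9 + (4/27)y³/(1-y/3)`, `E_2^{triple} = 1/2 + (y⁴+y⁶)/(4(2-y))`,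
`E_3^{triple} = 1/3 + (2/9)y/(1-y/3) + (y²/3)(1/3 + (4/9)y/(1-y/3))`, generic `E_p = 1 + k(y-1)/(p-y)`); sanity
`λ_f(1) = 1`, `λ_f(0) = 1, 1.320324, 2.640647, 2.858249 = C(f)` to 6 digits. Hub run to `N = 3.2·10⁷` (pure Python,
`compute/local/twins_small.py`; evidence `evidence_linsys_numerics.md` on the item):
```
ratio r_f(x,y)          y=1.25   y=1.5   y=1.74   y=1.75        (x = 10⁶ → 3.2·10⁷)
f = X   (THEOREM)       0.984→0.988  0.930→0.946  0.748→0.796  0.734→0.784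
(X, X+2)                0.975→0.981  0.915→0.935  0.738→0.785  0.725→0.773
(X, X+6)                0.968→0.975  0.885→0.912  0.679→0.743  0.665→0.731
(X, X+2, X+6)           0.959→0.968  0.885→0.912  0.709→0.767  0.696→0.756
fit r = a + b/log x over x ≥ 10⁶ (11 points):  a ∈ [0.986, 1.011] (X), [0.973, 1.015] (twins), [0.976, 1.016] (X,X+6),
[0.980, 1.019] (triple); slopes b(y=1.75) = -3.5 / -3.4 / -4.2 / -3.9.
```
So the planner's `0.725` (twins, `y = 1.75`, `x = 10⁶`) is reproduced AND matched by the proven `k = 1` law (`0.734` at the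
same point): it is the `O(1/log x)` secondary term of the Selberg–Delange expansion inflated near the pole of the `p = 2`
factor (`(1-y/2)⁻¹ = 8`), not a `k ≥ 2` phenomenon. All four systems rise monotonically toward `1` with fitted limits
`1.00 ± 0.03` and slopes within 25 % of the control's; a wrong Γ-power (`Γ(1.75)⁻¹ = 1.088` per factor), a missing
singular series (`1.32 / 2.64 / 2.86`) or a wrong `log`-exponent would appear as an `x`-independent offset `≥ 8 %` or a
drift of the wrong sign — none is seen. No misstatement signal for `k = 2, 3`; this is evidence, not proof.
Side data for the sibling crux `NormalFamilyBound` (same run, `compute/local/complex_small.py`): at the complex points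
`1.5+0.2i, 1+0.25i, 0.5+0.2i, 0.25i, -0.2, -0.2+0.1i ∈ V_{1/4}` every `|H_x(z)|` is stable to 2–3 digits over
`x = 10⁵ … 3.2·10⁷` for all four systems (e.g. twins at `z = -0.2`: `0.058 → 0.053`; triple at `0.25i`: `0.073 → 0.065`),
wild oscillation only outside `V` (`z = -1`: twins `2.5 … 45`, triple `10³–10⁴`). The farm jobs `j011124`/`j011129`
(to `10⁹`, with full `Ω_f` histograms) were still queued after 2 h on a saturated farm and are abandoned for this cycle; the
hub run settles the question they were meant to answer.
(For context: the constant of the `k = 2` law is a fractional-exponent analogue of the Additive Divisor Conjecture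
`Σ τ_k(n)τ_ℓ(n+h) ~ c_{k,ℓ}(h) x (log x)^{k+ℓ-2}/((k-1)!(ℓ-1)!)`, Ng–Thom arXiv:1609.01411 Conj. 1.1 — "for `k > 2` this
sum is mysterious and there are few results"; its conjectural constant comes from the same local model as `λ_f`.)

**(e) Refuted strengthening (new): holomorphy radius.** `not_lsdRealSegment_ball`: replacing `Metric.ball 0 2` by
`Metric.ball 0 R`, `R > 2`, is false at `f = X` (pole of `E_2` at `2`). With §5 the constant `2` is sharp in both
places; any proof must use `|z| < 2` for `Λ` AND `y < 2` for `H_x`, both through the prime `2` only (for the capped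
sibling statistic there is no wall: `SystemLSDRealSegment`).

**(f) For provers (learned from the disproof side).** (1) The `k = 1` linear rung in progressions (`f = qX + b`,
`Λ(0) = q/φ(q) = C`) needs Selberg–Delange for `z^{Ω}` twisted by Dirichlet characters — `L(s,χ)^z`, not covered by the
tree's `MontgomeryVaughan2007_thm_7_18` engine (`ζ(s)^z F(s,z)` with absolutely small `F`); it is the cheapest next
theorem-grade rung. (2) Shift invariance `f ↦ f(X + c)` holds trivially (boundary terms `≤ y^{Ω(n)} ≤ n^{log₂ y} = o(n)`),
so only systems up to translation matter. (3) The first open members, in increasing price: one quadratic (`n² + 1`: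
tilted smooth-value law of `n²+1`, level `x²`, no parity); twins (averaged prime-pair densities, dispersion); one cubic
(parity of the rough part at level `x` against size `x³`). -/

/-- SUMMARY of the negative knowledge on `LSDRealSegment` (cycle 1). [folklore] -/
theorem summary :
    (∀ f : Fin 0 → ℤ[X], Conclusion 0 f) ∧ ¬WithoutLeadingCoeffPos ∧ ¬WithoutIrreducible ∧ ¬WithoutPairwise ∧
      Conclusion 1 ![(C 3 : ℤ[X])] ∧
      (¬ ∀ (k : ℕ) (f : Fin k → ℤ[X]), IsBatemanHornSystem f → ∃ Λ : ℂ → ℂ, DifferentiableOn ℂ Λ (Metric.ball 0 2) ∧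
        Λ 0 = (batemanHornConst f : ℂ) ∧ ∀ y : ℝ, 5 / 4 < y → y ≤ 2 →
          Filter.Tendsto (fun x : ℕ => (x : ℂ)⁻¹
            * Complex.exp ((k : ℂ) * (1 - (y : ℂ)) * (Real.log (Real.log x) : ℂ)) *
            ∑ n ∈ Finset.range (x + 1), (y : ℂ) ^ (∑ i, cardFactors (((f i).eval (n : ℤ)).toNat))) Filter.atTop
            (nhds (Λ y * Complex.exp (((y : ℂ) - 1) * (Real.log (∏ i, ((f i).natDegree : ℝ)) : ℂ)) *
              (Complex.Gamma y)⁻¹ ^ k))) ∧ (∀ b : ℝ, 2 < b → ¬ ∀ (k : ℕ) (f : Fin k → ℤ[X]), IsBatemanHornSystem f →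
        ∃ Λ : ℂ → ℂ, DifferentiableOn ℂ Λ (Metric.ball 0 2) ∧ Λ 0 = (batemanHornConst f : ℂ) ∧
          ∀ y : ℝ, 5 / 4 < y → y < b → Filter.Tendsto (fun x : ℕ => (x : ℂ)⁻¹
            * Complex.exp ((k : ℂ) * (1 - (y : ℂ)) * (Real.log (Real.log x) : ℂ)) *
            ∑ n ∈ Finset.range (x + 1), (y : ℂ) ^ (∑ i, cardFactors (((f i).eval (n : ℤ)).toNat))) Filter.atTop
            (nhds (Λ y * Complex.exp (((y : ℂ) - 1) * (Real.log (∏ i, ((f i).natDegree : ℝ)) : ℂ)) *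
              (Complex.Gamma y)⁻¹ ^ k))) :=
  ⟨conclusion_fin_zero, false_without_leadingCoeff_pos, false_without_irreducible,
    false_without_pairwise_not_associated, conclusion_C_three, not_lsdRealSegment_upto_two,
    fun _ hb => not_lsdRealSegment_wide hb⟩


/-- SUMMARY of cycle 2 (§7): the crux holds at `f = X` with a rigid witness, and the holomorphy radius `2` is sharp.
[cite: MontgomeryVaughan2007, §7.4 Theorem 7.18 and (7.60)] -/
theorem summary₂ :
    Conclusion 1 ![X] ∧ DifferentiableOn ℂ selbergDelangeOmegaF (Metric.ball 0 2) ∧ selbergDelangeOmegaF 0 = 1 ∧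
      (∀ Λ : ℂ → ℂ, DifferentiableOn ℂ Λ (Metric.ball 0 2) → SegmentLaw 1 ![X] Λ →
        Set.EqOn Λ selbergDelangeOmegaF (Metric.ball 0 2) ∧ Λ 0 = 1) ∧
      (∀ y : ℝ, 1 ≤ y → y < 2 → 1 / 4 * (1 - y / 2)⁻¹ ≤ (selbergDelangeOmegaF y).re) ∧
      (∀ R : ℝ, 2 < R → ¬ ∀ (k : ℕ) (f : Fin k → ℤ[X]), IsBatemanHornSystem f → ∃ Λ : ℂ → ℂ,
        DifferentiableOn ℂ Λ (Metric.ball 0 R) ∧ Λ 0 = (batemanHornConst f : ℂ) ∧ ∀ y : ℝ, 5 / 4 < y → y < 7 / 4 →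
        Filter.Tendsto (fun x : ℕ => (x : ℂ)⁻¹
            * Complex.exp ((k : ℂ) * (1 - (y : ℂ)) * (Real.log (Real.log x) : ℂ)) *
          ∑ n ∈ Finset.range (x + 1), (y : ℂ) ^ (∑ i, cardFactors (((f i).eval (n : ℤ)).toNat))) Filter.atTop
          (nhds (Λ y * Complex.exp (((y : ℂ) - 1) * (Real.log (∏ i, ((f i).natDegree : ℝ)) : ℂ)) *
            (Complex.Gamma y)⁻¹ ^ k))) :=
  ⟨conclusion_X, differentiableOn_selbergDelangeOmegaF, selbergDelangeOmegaF_zero,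
    fun _ hΛ hlaw => ⟨eqOn_selbergDelangeOmegaF_of_segmentLaw_X hΛ hlaw, apply_zero_eq_one_of_segmentLaw_X hΛ hlaw⟩,
    fun _ hy1 hy2 => re_selbergDelangeOmegaF_ge hy1 hy2, fun _ hR => not_lsdRealSegment_ball hR⟩


/-- SUMMARY of cycle 2, second half (§7e): two proved members with two different pins. [folklore] -/
theorem summary₃ : Conclusion 1 ![X] ∧ Conclusion 1 ![C 2 * X + C 1] ∧
    batemanHornConst (![X] : Fin 1 → ℤ[X]) = 1 ∧ batemanHornConst (![C 2 * X + C 1] : Fin 1 → ℤ[X]) = 2 :=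
  ⟨conclusion_X, conclusion_twoX_add_one, batemanHornConst_X, batemanHornConst_twoX_add_one⟩

end

end Summit.Parity.BatemanHorn.Cruxes.LSDRealSegment.Disproof
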